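import Literature.Claims.NS.ClayR3BKMBridge
import Literature.Analysis.FluidPDE.ClayClassLerayHopfUniqueness
import Literature.Analysis.FluidPDE.ConstantinFeffermanEnstrophySlab
import Literature.Analysis.FluidPDE.TaoClassGlue
import Literature.Analysis.FluidPDE.DriftDiffusionMaxPrinciple
import Literature.Analysis.FluidPDE.EnstrophyWeightSlab
import Literature.Analysis.FluidPDE.BiotSavartRepresentationSqIntegrable
import Literature.Analysis.FluidPDE.BiotSavartSupInterpolation
import HarnessLib

/-!
# Claim skeleton (D-0090 NS-CLAIMS, C142): Rhodes 2026 — «Navier–Stokes Existence and Smoothness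
# via the Self-Defeating Enstrophy Boundary»

Typed skeleton of John Rhodes, *Navier–Stokes Existence and Smoothness via the Self-Defeating
Enstrophy Boundary*, Zenodo record 19560332 (concept 10.5281/zenodo.19560331, «Version 9d», April
2026, 21 pp.; PDF sha16 `013d4004e5b80e46`; PDF page = printed page) = bib `Rhodes2026`, text of
record of cell `ns-claims` row C142 (census pin `run/shared/lean/pub/ns-claims/census/texts/Rhodes2026/`,
pages `pNNN.txt`; line numbers `l.N` below are the lines of those page files). UNREFEREED CLAIM under
adjudication — NOTHING in this file asserts a step of the paper: the paper's statements are
`def … : Prop`; the `theorem`s are kernel compositions of the paper's own implications, the Clay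
identification, and classical facts PROVED from the tree (local existence in the class, the compact
sub-slab face of Theorem 4.1, the BKM continuation Theorem 5.1, the energy bound (c), the uniqueness
rider (d), and «Theorem 4.1 ⇒ (A)» through the tree's Beale–Kato–Majda door). Verdict vocabulary is
the refuter's / referee's.

## The claimed statement, as printed (Thm 1.1 p.3 l.32–54)
«Theorem 1.1 (Main Result). Let u₀ : ℝ³ → ℝ³ be a smooth, divergence-free vector field satisfying
|D^α u₀(x)| ≤ C_{αK}(1 + |x|)^{−K} for every multi-index α and every K > 0. Let ν > 0. Then:
(a) Existence. There exist smooth functions u : ℝ³ × [0,∞) → ℝ³ and p : ℝ³ × [0,∞) → ℝ satisfying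
(1)–(3). (b) Smoothness. u, p ∈ C^∞(ℝ³ × [0,∞)). (c) Energy bound. ∫|u(x,t)|² dx ≤ ∫|u₀(x)|² dx for
all t ≥ 0. (d) Uniqueness. The solution is unique in the class of smooth solutions with bounded
energy.» ((1)–(3) p.3 l.14–30 = Fefferman's (1)(2)(3) with `f ≡ 0`.) This is Clay (A) token for
token ((c) is the monotone form of (7)), plus the classical rider (d): `ClaimedTheorem` below;
`clay_of_claimed : ClaimedTheorem → ClayVariants.clayR3.Regularity` is a projection (no Δ-axis).

## Architecture of the printed proof (p.3 l.55–60 «five steps») and the typed Steps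
§2 (pp.3–4): vorticity equation (4), enstrophy balance (5) `dE/dt = ∫P − ∫D`, `E = ½∫|ω|²`,
`P = ωᵢSᵢⱼωⱼ` (6), `D = ν|∇ω|²` (7). §3: Thm 3.1 (pp.4–5, `∫D = 0 ⇔ ω ≡ 0`; TRUE, typed
`Theorem31`); Remark 3.3 (ν = 0 fails); **Lemma 3.4** (8) p.5 `|u(x)| ≤ C₁ M^{1/3} E^{1/3}`,
`M = ‖ω‖_∞`, `E = ½‖ω‖²₂` (Biot–Savart near/far split; TRUE-type, `Lemma34`); **Lemma 3.6** (9) p.6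
`M ≤ C₀ E(t₀)² L⁶/ν³`, `L = 1 + ln⁺(e + ‖ω‖_{H^s}/√(2E))`, `s > 5/2`, `C₀` absolute (LOAD-BEARING;
`Lemma36`), with its printed proof Steps 1–5 pp.6–11: (10)–(11) superharmonic condition at the
maximum (`Step1_Superharmonic11`, TRUE), (a)/(b) p.6 (`Step2_MaxIdentities`, TRUE), the BKM-type
bound «`|P| ≤ M²‖∇u‖_∞ ≤ C₂M³L`» p.6 l.89 = (25) p.9 (`Step2_BKMLog`), (12)–(13) p.7 «(combining (a)
and (b))» (`Step2_Display13`), (14) (`Step2_Display14`), (19) p.8 (`Step3_Display19`), (26)–(30)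
pp.9–10 (`Step3c_Display30`), (31)–(34) p.11 (`Step3d_Display34`), (36)–(37) p.11. §4: Thm 4.1 (38)
p.12 in two faces — the literal / compact-sub-slab face `Theorem41Compact` (PROVED TRUE in the class:
`theorem41Compact_holds`, hence vacuous as a step) and the face §5.2 consumes, `Theorem41` (uniform
sup-vorticity bound on the half-open `[0, T)`; ⇔ Clay (A) by the tree's door) —, Prop 4.2 (42) p.13
(`Prop42`, TRUE-type), (40)–(41) p.13 (`Step_Gronwall41`, TRUE-type), Step 3 «log closure» (44) p.14
(`Step3_LogClosure`, `E₀` = sup of the enstrophy as Prop 4.2 defines it; and the printed inference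
`Step3_Closure : Lemma36 → Prop42 → Step3_LogClosure`), Step 4 «bootstrap» p.14 with Remark 4.3
(`Step4_Bootstrap : Step3_LogClosure → Step_Gronwall41 → Theorem41`, the printed inference). §5:
Thm 5.1 BKM (45) p.15 (`Theorem51`, PROVED: `theorem51_holds`) and §5.2 conclusion — PROVED here from
`Theorem41` by the tree's door `ClayVariants.clayR3_regularity_iff_aprioriVorticityBound`
(`clayA_of_theorem41`). §6 Prop 6.1 energy identity (46) p.16 ⇒ (c) (`Prop61`, PROVED: `prop61_holds`,
Leray–Hopf energy inequality). §7 uniqueness (47) p.16 = (d) — PROVED (`uniquenessD_holds`, Tao 2013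
L8.1 + Cor 11.1 + Prodi–Serrin). COMPOSITION: `claim_of_steps : Theorem41 → ClaimedTheorem` (PROVED;
(c) and (d) are theorems), and the printed sub-chain `theorem41_of_printed : Lemma36 → Prop42 →
Step3_Closure → Step_Gronwall41 → Step4_Bootstrap → Theorem41` (PROVED, pure logic: the two
inference Steps ARE the printed implications). So every distance to Clay (A) sits in `Lemma36`
(with its proof displays (12)–(13), `Step2_BKMLog`) and `Step4_Bootstrap`; `Step0_LocalExistence`,
`Theorem41Compact`, `Theorem51`, `Prop61`, `UniquenessD` are certified TRUE in the kernel.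

## Typing conventions (cell TYPING-HYGIENE)
* Solutions: the class the proof runs in (Thm 3.1 p.4 l.45–48 «smooth solution of (1)–(3) on ℝ³ with
  ν > 0 and finite energy»; Remark 3.2 «on its maximal interval of existence [0, T*)»; §5.2 p.15
  l.43–44 «By local existence (Leray [3], Kato [4]), a smooth solution exists on a maximal interval
  [0, T*)»): `IsSol ν u₀ T u p` = classical solution of the unforced system on `ℝ³ × [0, T)`
  (tree `IsClassicalNSSolutionOn (Ico 0 T)`), `u 0 = u₀` a Clay datum (smooth, divergence free,
  (4) `HasRapidSpatialDecay`), energy bounded on `[0, T)`.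
* No suprema (HYGIENE 1): `M = ‖ω(·,t₀)‖_∞` enters through «for all x, |ω(x,t₀)| ≤ …» or through an
  attained maximum `IsVortMax` (the paper: «the supremum is attained at some x₀», p.6 l.32–35);
  `|∇ω|²` is the Hilbert–Schmidt square `gradSq` ((10): `Δ|ω|² = 2|∇ω|² + 2ω·Δω`); `E(t)`, the `H³`
  quantity inside `L`, `P`, `D` are Bochner integrals / finite sums (junk-free in the class, where all
  slices are Schwartz-like by Tao 2013 Cor. 11.1). `L` is typed at the admissible instance `s = 3` of
  «s > 5/2» with the `H³` norm `(Σ_{n≤3} ∫|Dⁿω|²)^{1/2}` — TODO(general form): real `s > 5/2`.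
* Constants «absolute»/«universal» (C₀, C₁, C₂, C₃, C̃, α₀: Remark 3.11 p.12) are existentially
  quantified BEFORE ν, the datum and the solution, as printed.

Cell files: `claims/Rhodes2026/CARD.md` (typist-1 g5; PREDICTION sealed 2026-08-27T09:16Z, sha16
4971ea39f6114522). WHAT THIS IS NOT: not a claim about NS regularity or blow-up; not a claim about any
author beyond the typed locator.
-/

noncomputable section

open MeasureTheory Set Filter Topology
open scoped ENNReal NNReal ContDiff RealInnerProductSpace Laplacian

namespace Literature.Claims.NS.Rhodes2026

open Literature.Analysis.FluidPDE Literature.Claims.NS.ClayVariants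

/-! ## Vocabulary -/

/-- Physical space `ℝ³`. [folklore] -/
abbrev E3 : Type := EuclideanSpace ℝ (Fin 3)

/-- A Clay datum (Thm 1.1 hypotheses p.3 l.32–36): smooth, divergence free, Fefferman's decay (4).
[cite: Rhodes2026, Thm 1.1 p.3 l.32–36] -/
def IsDatum (u₀ : E3 → E3) : Prop :=
  ContDiff ℝ ∞ u₀ ∧ NSWave0.IsDivFree u₀ ∧ HasRapidSpatialDecay u₀

/-- **The class the printed proof runs in**: a smooth solution of (1)–(3) on `ℝ³ × [0, T)` from the
Clay datum `u₀`, with finite energy on `[0, T)` (Thm 3.1 p.4 l.45–48 «Let u be a smooth solution of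
(1)–(3) on ℝ³ with ν > 0 and finite energy E₀ = ‖u₀‖²_{L²} < ∞»; Remark 3.2 p.5 l.27–31 «it applies to
the smooth solution on its maximal interval of existence [0, T*)»; §5.2 p.15 l.43–44).
[cite: Rhodes2026, Thm 3.1 p.4; Remark 3.2 p.5; §5.2 p.15] -/
structure IsSol (ν : ℝ) (u₀ : E3 → E3) (T : ℝ) (u : ℝ → E3 → E3) (p : ℝ → E3 → ℝ) : Prop where
  datum : IsDatum u₀
  classical : IsClassicalNSSolutionOn (Ico 0 T) ν 0 u p
  initial : u 0 = u₀
  energy : ∃ A : ℝ≥0∞, A < ⊤ ∧ ∀ t ∈ Ico 0 T, ∫⁻ x, ‖u t x‖ₑ ^ 2 ≤ A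

/-- «the supremum is attained at some x₀ ∈ ℝ³ with |ω(x₀, t₀)| = M» (Lemma 3.6 p.6 l.32–35): `x₀` is
a point of spatial maximum of `|ω(·, t)|`, `ω = curl u`. [cite: Rhodes2026, Lemma 3.6 p.6 l.32–35] -/
def IsVortMax (u : ℝ → E3 → E3) (t : ℝ) (x₀ : E3) : Prop :=
  ∀ y : E3, ‖curl (u t) y‖ ≤ ‖curl (u t) x₀‖

/-- The enstrophy `E(t) = ½ ∫ |ω|² dx` ((5) p.4 l.5–11; Lemma 3.4: `E = ½‖ω‖²_{L²}`).
[cite: Rhodes2026, (5) p.4] -/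
def enstrophy (u : ℝ → E3 → E3) (t : ℝ) : ℝ :=
  (1 / 2) * ∫ x, ‖curl (u t) x‖ ^ 2

/-- `|∇w(x)|² = Σᵢⱼ (∂ᵢwⱼ)²` (Hilbert–Schmidt square of the gradient; the quantity in `D = ν|∇ω|²`
(7) and in (10) `Δ|ω|² = 2|∇ω|² + 2ω·Δω`). [cite: Rhodes2026, (7) p.4; (10) p.6] -/
def gradSq (w : E3 → E3) (x : E3) : ℝ :=
  ∑ i : Fin 3, ‖fderiv ℝ w x (EuclideanSpace.single i (1 : ℝ))‖ ^ 2

/-- The local enstrophy production `P = ωᵢ Sᵢⱼ ωⱼ` ((6) p.4; `S` the symmetric part of `∇u`, so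
`ωᵢSᵢⱼωⱼ = ⟪ω, (∇u) ω⟫`). [cite: Rhodes2026, (6) p.4] -/
def production (v : E3 → E3) (x : E3) : ℝ :=
  ⟪curl v x, fderiv ℝ v x (curl v x)⟫

/-- The local dissipation `D = ν |∇ω|²` ((7) p.4). [cite: Rhodes2026, (7) p.4] -/
def dissipation (ν : ℝ) (v : E3 → E3) (x : E3) : ℝ :=
  ν * gradSq (curl v) x

/-- `‖w‖²_{H³} = Σ_{n ≤ 3} ∫ |Dⁿ w|²` — the Sobolev quantity inside the logarithmic factor `L`, at the
admissible instance `s = 3` of «s > 5/2» (TODO(general form): real `s > 5/2`).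
[cite: Rhodes2026, Lemma 3.6 (9) p.6 l.42–45] -/
def h3NormSq (w : E3 → E3) : ℝ :=
  ∑ n ∈ Finset.range 4, ∫ x, ‖iteratedFDeriv ℝ n w x‖ ^ 2

/-- «L = 1 + ln⁺(e + ‖ω‖_{H^s}/√(2E)) … the logarithmic interpolation factor» (Lemma 3.6 p.6 l.42–45),
at `s = 3`. [cite: Rhodes2026, Lemma 3.6 (9) p.6 l.42–45] -/
def logFactor (u : ℝ → E3 → E3) (t : ℝ) : ℝ :=
  1 + max 0 (Real.log (Real.exp 1 + Real.sqrt (h3NormSq (curl (u t))) / Real.sqrt (2 * enstrophy u t)))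

/-- `1 ≤ L` («L = 1 + ln⁺(···) ≥ 1 by definition», p.11 l.107–110). [cite: Rhodes2026, p.11 l.107–110] -/
theorem one_le_logFactor (u : ℝ → E3 → E3) (t : ℝ) : 1 ≤ logFactor u t := by
  unfold logFactor
  have := le_max_left (0 : ℝ) (Real.log (Real.exp 1 +
    Real.sqrt (h3NormSq (curl (u t))) / Real.sqrt (2 * enstrophy u t)))
  linarith

/-- A Clay-class solution (Thm 1.1 (a)(b) + «smooth solutions with bounded energy», (d) p.3 l.53–54):
`u, p ∈ C^∞(ℝ³ × [0,∞))`, (1)–(3) with `f ≡ 0` and datum `u₀`, bounded energy (7).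
[cite: Rhodes2026, Thm 1.1 (a)(b)(d) p.3] -/
def IsClaySol (ν : ℝ) (u₀ : E3 → E3) (u : ℝ → E3 → E3) (p : ℝ → E3 → ℝ) : Prop :=
  IsSmoothOnHalfSpace u ∧ IsSmoothOnHalfSpace p ∧ IsNavierStokesSolution ν 0 u₀ u p ∧ HasBoundedEnergy u

/-! ## The claimed statement -/

/-- Thm 1.1 (d) p.3 l.53–54: «The solution is unique in the class of smooth solutions with bounded
energy» — two Clay-class solutions from the same datum have the same velocity.
[claim: Rhodes2026, status: under-review] [cite: Rhodes2026, Thm 1.1 (d) p.3; §7 (47) p.16] -/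
def UniquenessD : Prop :=
  ∀ ν : ℝ, 0 < ν → ∀ u₀ : E3 → E3, IsDatum u₀ →
    ∀ (u₁ : ℝ → E3 → E3) (p₁ : ℝ → E3 → ℝ) (u₂ : ℝ → E3 → E3) (p₂ : ℝ → E3 → ℝ),
      IsClaySol ν u₀ u₁ p₁ → IsClaySol ν u₀ u₂ p₂ → ∀ t : ℝ, 0 ≤ t → u₁ t = u₂ t

/-- **CLAIMED THEOREM = Thm 1.1 p.3 l.32–54 (a)–(d), as printed**: for every `ν > 0` and every Clay
datum `u₀`: (a)(b) smooth `u, p` on `ℝ³ × [0,∞)` solving (1)–(3) with `f ≡ 0`, (c) the energy bound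
`∫|u(t)|² ≤ ∫|u₀|²` for all `t ≥ 0`, and (d) uniqueness among smooth bounded-energy solutions.
[claim: Rhodes2026, status: under-review] [cite: Rhodes2026, Thm 1.1 p.3 l.32–54] -/
def ClaimedTheorem : Prop :=
  (∀ ν : ℝ, 0 < ν → ∀ u₀ : E3 → E3, IsDatum u₀ →
    ∃ (u : ℝ → E3 → E3) (p : ℝ → E3 → ℝ),
      IsSmoothOnHalfSpace u ∧ IsSmoothOnHalfSpace p ∧ IsNavierStokesSolution ν 0 u₀ u p ∧
        ∀ t : ℝ, 0 ≤ t → ∫⁻ x, ‖u t x‖ₑ ^ 2 ≤ ∫⁻ x, ‖u₀ x‖ₑ ^ 2) ∧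
  UniquenessD

/-! ## The Steps of the printed argument -/

/-- **Step 0 — local existence / the maximal smooth solution** (§5.2 p.15 l.43–44 «By local existence
(Leray [3], Kato [4]), a smooth solution exists on a maximal interval [0, T*)»; p.8 l.4 «the smooth
solution exists past t₀ by local existence (Kato [4])»): every Clay datum launches a solution of the
class on some `[0, T)`, `T > 0`. Classical (tree: `ClayVariants.clayR3_solvable_or_supBlowup`).
[claim: Rhodes2026, status: under-review] [cite: Rhodes2026, §5.2 p.15 l.43–44; p.8 l.4] -/
def Step0_LocalExistence : Prop :=
  ∀ ν : ℝ, 0 < ν → ∀ u₀ : E3 → E3, IsDatum u₀ →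
    ∃ T : ℝ, 0 < T ∧ ∃ (u : ℝ → E3 → E3) (p : ℝ → E3 → ℝ), IsSol ν u₀ T u p

/-- **Theorem 3.1 (ii) pp.4–5** («Integral: ∫D dx = 0 if and only if ω(·,t) ≡ 0»; proof: a continuous
nonnegative function with vanishing integral vanishes, so ∇ω ≡ 0, ω constant, and a nonzero constant
vorticity is incompatible with finite energy). TRUE (typist's flag: classical).
[claim: Rhodes2026, status: under-review] [cite: Rhodes2026, Thm 3.1 (ii) p.4 l.52–54, proof p.4 l.61–p.5 l.15] -/
def Theorem31 : Prop :=
  ∀ (ν : ℝ) (u₀ : E3 → E3) (T : ℝ) (u : ℝ → E3 → E3) (p : ℝ → E3 → ℝ), 0 < ν → IsSol ν u₀ T u p →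
    ∀ t ∈ Ico 0 T, (∫ x, dissipation ν (u t) x) = 0 ↔ ∀ x, curl (u t) x = 0

/-- **Lemma 3.4 (8) p.5 — uniform velocity bound** «Let M = ‖ω‖_{L^∞} and E = ½‖ω‖²_{L²}. Then for
every x ∈ ℝ³: |u(x)| ≤ C₁ M^{1/3} E^{1/3}», `C₁ = 2(2/(4π))^{1/3}` (proof pp.5–6: Biot–Savart split at
radius R, near field ≤ MR, far field ≤ √(2E)/√(4πR), optimise). Typed along the solutions of the class
(where `u(t)` IS the Biot–Savart integral of `ω(t)`), with ONE absolute constant. Typist's flag: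
TRUE-type (classical potential estimate). [claim: Rhodes2026, status: under-review] [cite: Rhodes2026, Lemma 3.4 (8) p.5 l.44–58, proof p.5 l.59–p.6 l.23] -/
def Lemma34 : Prop :=
  ∃ C₁ : ℝ, 0 < C₁ ∧
    ∀ (ν : ℝ) (u₀ : E3 → E3) (T : ℝ) (u : ℝ → E3 → E3) (p : ℝ → E3 → ℝ), 0 < ν → IsSol ν u₀ T u p →
      ∀ t ∈ Ico 0 T, ∀ M : ℝ, (∀ y, ‖curl (u t) y‖ ≤ M) →
        ∀ x, ‖u t x‖ ≤ C₁ * M ^ (1 / 3 : ℝ) * (enstrophy u t) ^ (1 / 3 : ℝ)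

/-- **Lemma 3.6 proof, Step 1 — the superharmonic constraint (10)–(11) p.6** «Since |ω|² achieves its
global maximum M² at x₀: Δ|ω|²(x₀) = 2|∇ω(x₀)|² + 2ω(x₀)·Δω(x₀) ≤ 0. Therefore
|∇ω(x₀)|² ≤ −ω(x₀)·Δω(x₀) ≤ M|Δω(x₀)|.» Typed for every `C²` field at a point of maximum of its
modulus. TRUE (calculus; typist's flag). [claim: Rhodes2026, status: under-review] [cite: Rhodes2026, (10)–(11) p.6 l.53–62] -/
def Step1_Superharmonic11 : Prop :=
  ∀ (w : E3 → E3) (x₀ : E3), ContDiff ℝ 2 w → (∀ y, ‖w y‖ ≤ ‖w x₀‖) →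
    gradSq w x₀ ≤ -⟪w x₀, Δ w x₀⟫ ∧ -⟪w x₀, Δ w x₀⟫ ≤ ‖w x₀‖ * ‖Δ w x₀‖

/-- **Lemma 3.6 proof, Step 2 (a)–(b) p.6 l.65–90 — the two identities at the maximum**: «(a)
ω(x₀)·(u·∇)ω(x₀) = (u·∇)(½|ω|²)|_{x₀} = 0, since ∇|ω|² = 0 at the maximum. (b) ω(x₀)·∂ₜω(x₀) =
½∂ₜ|ω(x₀,t)|²|_{t₀} … From the enstrophy density equation at the maximum, using Δ|ω|² ≤ 0 and the BKM
estimate … we obtain ω(x₀)·∂ₜω(x₀) ≤ P(x₀)» — typed as the two facts the sequel consumes: at a spatial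
maximum `x₀` of `|ω(·,t₀)|` along a solution of the class, `⟪ω, (u·∇)ω⟫(x₀) = 0` and
`⟪ω, ∂ₜω⟫(x₀) ≤ P(x₀)` (one-sided time derivative within `[0,T)`). TRUE (typist's flag; vorticity
equation (4) + `ω·Δω = ½Δ|ω|² − |∇ω|² ≤ 0`). [claim: Rhodes2026, status: under-review] [cite: Rhodes2026, Step 2 (a)(b) p.6 l.63–90] -/
def Step2_MaxIdentities : Prop :=
  ∀ (ν : ℝ) (u₀ : E3 → E3) (T : ℝ) (u : ℝ → E3 → E3) (p : ℝ → E3 → ℝ), 0 < ν → IsSol ν u₀ T u p →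
    ∀ t₀ ∈ Ico 0 T, ∀ x₀ : E3, IsVortMax u t₀ x₀ →
      ⟪curl (u t₀) x₀, fderiv ℝ (curl (u t₀)) x₀ (u t₀ x₀)⟫ = 0 ∧
      ⟪curl (u t₀) x₀, timeDerivWithin (Ico 0 T) (fun t x => curl (u t) x) t₀ x₀⟫ ≤
        production (u t₀) x₀

/-- **The BKM-type sup bound used throughout** (p.6 l.89 «the BKM estimate |P| ≤ M²‖∇u‖_∞ ≤ C₂M³L»;
p.7 l.9–10 «|(ω·∇)u(x₀)| ≤ M‖∇u‖_∞ ≤ C₂M²L»; p.8 l.14 «the BKM estimate ‖∇u(·,t)‖_{L^∞} ≤ C₂ M(t) L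
(which is a global bound …)»; (25) p.9 at `m = 0`): `‖∇u(·,t)‖_∞ ≤ C₂ M L` with
`L = 1 + ln⁺(e + ‖ω‖_{H^s}/‖ω‖_{L²})`, ONE absolute `C₂` (Remark 3.11: `C₂ ≤ C_CZ ≤ 10`). Typist's
flag: suspicious — homogeneous of degree one under the dilation `u(x) ↦ u(λx)`, under which the
(inhomogeneous) ratio `‖ω‖_{H³}/‖ω‖_{L²} → 1` as `λ → 0`, so the display would force
`‖∇u‖_∞ ≤ C₂(1 + ln(e + 1))‖ω‖_∞`, the endpoint `L^∞` Calderón–Zygmund bound (tree barrier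
`Literature.Barriers.NavierStokesRegularity.SupNormCalderonZygmundFailure`); refuter's call.
[claim: Rhodes2026, status: under-review] [cite: Rhodes2026, p.6 l.89; p.8 l.14; (25) p.9 l.76–79] -/
def Step2_BKMLog : Prop :=
  ∃ C₂ : ℝ, 0 < C₂ ∧
    ∀ (ν : ℝ) (u₀ : E3 → E3) (T : ℝ) (u : ℝ → E3 → E3) (p : ℝ → E3 → ℝ), 0 < ν → IsSol ν u₀ T u p →
      ∀ t ∈ Ico 0 T, ∀ M : ℝ, (∀ y, ‖curl (u t) y‖ ≤ M) →
        ∀ x, ‖fderiv ℝ (u t) x‖ ≤ C₂ * M * logFactor u t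

/-- **Lemma 3.6 proof, Step 2, displays (12)–(13) p.7 l.15–25** «The projected equation gives:
ν|ω·Δω|/M ≤ C₂M²L (combining (a) and (b)). … From (10): cos θ ≤ 0 and |∇ω|² ≤ M|Δω||cos θ|. Therefore:
|∇ω(x₀)|² ≤ M|Δω||cos θ| ≤ C₂M³L/ν. (13)» (also (17) p.8 «at the moving maximum»). Typed as the
displayed bound at any spatial maximum `x₀` of `|ω(·,t₀)|` along a solution of the class, with ONE
absolute `C₂`, `M = |ω(x₀,t₀)|`, `L = L(t₀)`. Typist's flag: SUSPICIOUS, the cell's pre-registered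
candidate — (b) bounds `ω·∂ₜω` from ABOVE only, so «combining (a) and (b)» does not bound `|ω·Δω|`;
and the display is cubic in the amplitude on the right, quadratic on the left.
[claim: Rhodes2026, status: under-review] [cite: Rhodes2026, (12)–(13) p.7 l.15–25; (17) p.8 l.14–22] -/
def Step2_Display13 : Prop :=
  ∃ C₂ : ℝ, 0 < C₂ ∧
    ∀ (ν : ℝ) (u₀ : E3 → E3) (T : ℝ) (u : ℝ → E3 → E3) (p : ℝ → E3 → ℝ), 0 < ν → IsSol ν u₀ T u p →
      ∀ t₀ ∈ Ico 0 T, ∀ x₀ : E3, IsVortMax u t₀ x₀ →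
        ν * |⟪curl (u t₀) x₀, Δ (curl (u t₀)) x₀⟫| ≤ C₂ * ‖curl (u t₀) x₀‖ ^ 3 * logFactor u t₀ ∧
        gradSq (curl (u t₀)) x₀ ≤ C₂ * ‖curl (u t₀) x₀‖ ^ 3 * logFactor u t₀ / ν

/-- **Lemma 3.6 proof, Step 2, display (14) p.7 l.70–82** «there exists a threshold M₁ = M₁(E, ν, L)
such that for M > M₁ … |Δω(x₀)| ≤ C₃M²L/ν (14), where C₃ ≥ C₂ absorbs the constants». Typed with the
threshold depending on `(E(t₀), ν, L(t₀))` only. [claim: Rhodes2026, status: under-review] [cite: Rhodes2026, (14) p.7 l.70–82] -/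
def Step2_Display14 : Prop :=
  ∃ C₃ : ℝ, 0 < C₃ ∧ ∃ M₁ : ℝ → ℝ → ℝ → ℝ,
    ∀ (ν : ℝ) (u₀ : E3 → E3) (T : ℝ) (u : ℝ → E3 → E3) (p : ℝ → E3 → ℝ), 0 < ν → IsSol ν u₀ T u p →
      ∀ t₀ ∈ Ico 0 T, ∀ x₀ : E3, IsVortMax u t₀ x₀ →
        M₁ (enstrophy u t₀) ν (logFactor u t₀) < ‖curl (u t₀) x₀‖ →
          ‖Δ (curl (u t₀)) x₀‖ ≤ C₃ * ‖curl (u t₀) x₀‖ ^ 2 * logFactor u t₀ / ν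

/-- **Lemma 3.6 proof, Step 3a, display (19) p.8 l.37–63** «|dm/dt| ≤ 4C₂ m^{3/2} L. This is a
Bernoulli-type inequality … M* := sup_{[t₀−δt, t₀+δt]} ‖ω(·,t)‖_{L^∞} ≤ 2M (19)», `δt = 1/(4C₃ML)`
((15) p.7). Typed: within the existence interval, `‖ω(·,t)‖_∞ ≤ 2M` for `|t − t₀| ≤ 1/(4C₃ M L(t₀))`
(the part of the window inside `[0,T)`), `M = |ω(x₀,t₀)| > 0`. [claim: Rhodes2026, status: under-review]
[cite: Rhodes2026, (15) p.7 l.84–92; (16)–(19) p.8 l.2–63] -/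
def Step3_Display19 : Prop :=
  ∃ C₃ : ℝ, 0 < C₃ ∧
    ∀ (ν : ℝ) (u₀ : E3 → E3) (T : ℝ) (u : ℝ → E3 → E3) (p : ℝ → E3 → ℝ), 0 < ν → IsSol ν u₀ T u p →
      ∀ t₀ ∈ Ico 0 T, ∀ x₀ : E3, IsVortMax u t₀ x₀ → 0 < ‖curl (u t₀) x₀‖ →
        ∀ t ∈ Ico 0 T, |t - t₀| ≤ 1 / (4 * C₃ * ‖curl (u t₀) x₀‖ * logFactor u t₀) →
          ∀ y, ‖curl (u t) y‖ ≤ 2 * ‖curl (u t₀) x₀‖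

/-- The threshold «M_thr := 2C₁⁶ E²/(ν³L³)» ((27) p.10 l.42–48) of the «universal regime».
[cite: Rhodes2026, (27) p.10 l.42–48] -/
def mThr (C₁ E ν L : ℝ) : ℝ :=
  2 * C₁ ^ 6 * E ^ 2 / (ν ^ 3 * L ^ 3)

/-- **Lemma 3.6 proof, Step 3c, displays (26)–(30) pp.9–10** «‖∇ᵏω‖_{L^∞(Q′)} ≤ A_k M / r₀ᵏ,
A_k ≤ C̃ᵏ (30), where C̃ is a universal constant, valid for all M > M_thr», `r₀ = ½√(ν/(C₃ML))` ((15)),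
`Q′ = B(x₀, α₀r₀) × [t₀ − δt/2, t₀ + δt/2]` ((21)). Typed at the time slice `t₀` on the ball
`B(x₀, r₀/2)` (any fixed interior sub-ball; the constant absorbs the choice), for `M > M_thr` with the
Lemma 3.4 constant `C₁`. Typist's flag: suspicious (parabolic interior estimates give `Cᵏ k!`, not `Cᵏ`;
immaterial for Step 3d). [claim: Rhodes2026, status: under-review] [cite: Rhodes2026, (26)–(30) p.10 l.15–108; (15) p.7; (21) p.8] -/
def Step3c_Display30 : Prop :=
  ∃ C₁ C₃ Ct : ℝ, 0 < C₁ ∧ 0 < C₃ ∧ 0 < Ct ∧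
    ∀ (ν : ℝ) (u₀ : E3 → E3) (T : ℝ) (u : ℝ → E3 → E3) (p : ℝ → E3 → ℝ), 0 < ν → IsSol ν u₀ T u p →
      ∀ t₀ ∈ Ioo 0 T, ∀ x₀ : E3, IsVortMax u t₀ x₀ →
        mThr C₁ (enstrophy u t₀) ν (logFactor u t₀) < ‖curl (u t₀) x₀‖ →
          ∀ k : ℕ, ∀ y ∈ Metric.ball x₀ ((1 / 2) * ((1 / 2) * Real.sqrt (ν / (C₃ * ‖curl (u t₀) x₀‖ * logFactor u t₀)))),
            ‖iteratedFDeriv ℝ k (curl (u t₀)) y‖ ≤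
              Ct ^ k * ‖curl (u t₀) x₀‖ /
                ((1 / 2) * Real.sqrt (ν / (C₃ * ‖curl (u t₀) x₀‖ * logFactor u t₀))) ^ k

/-- **Lemma 3.6 proof, Step 3d–4, display (34) and (35) p.11 l.49–69** «|ω(y)| ≥ |ω(x₀)| − |ω(y) −
ω(x₀)| ≥ M − Mσ(α₀) ≥ M/2 (34) for all y ∈ B(x₀, α₀r₀)», «ρ₀ := α₀r₀ = (α₀/2)√(ν/(C₃ML)) (35), where
α₀ > 0 is the universal constant from Step 3d», in the universal regime `M > M_thr`.
[claim: Rhodes2026, status: under-review] [cite: Rhodes2026, (31)–(35) p.11 l.2–69] -/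
def Step3d_Display34 : Prop :=
  ∃ C₁ C₃ α₀ : ℝ, 0 < C₁ ∧ 0 < C₃ ∧ 0 < α₀ ∧
    ∀ (ν : ℝ) (u₀ : E3 → E3) (T : ℝ) (u : ℝ → E3 → E3) (p : ℝ → E3 → ℝ), 0 < ν → IsSol ν u₀ T u p →
      ∀ t₀ ∈ Ioo 0 T, ∀ x₀ : E3, IsVortMax u t₀ x₀ →
        mThr C₁ (enstrophy u t₀) ν (logFactor u t₀) < ‖curl (u t₀) x₀‖ →
          ∀ y ∈ Metric.ball x₀ ((α₀ / 2) * Real.sqrt (ν / (C₃ * ‖curl (u t₀) x₀‖ * logFactor u t₀))),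
            ‖curl (u t₀) x₀‖ / 2 ≤ ‖curl (u t₀) y‖

/-- **LEMMA 3.6 (9) p.6 l.30–45 = (37) p.11 — the vorticity bound at the maximum (LOAD-BEARING)**:
«Let u be a smooth solution of (1)–(3) on ℝ³ with ν > 0. Let M = ‖ω(·,t₀)‖_{L^∞}. … Then
M ≤ C₀ E(t₀)² L⁶/ν³ (9), where L = 1 + ln⁺(e + ‖ω‖_{H^s}/√(2E)) for s > 5/2 … and C₀ is an absolute
constant» (Remark 3.11 p.12: `C₀ = 1/C₆² ≈ 3.7 × 10¹³`). Typed: ONE absolute `C₀`; for every solution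
of the class and every `t₀ ∈ [0, T)`, every value `|ω(x,t₀)|` is at most `C₀ E(t₀)² L(t₀)⁶/ν³`
(equivalently `M ≤ …`; no supremum needed), `L` at `s = 3`. Typist's flag: SUSPICIOUS — left side
linear, right side quartic in the amplitude of the solution (`E ∝ A²`, `L` amplitude-invariant), and
the printed proof rests on (13). [claim: Rhodes2026, status: under-review] [cite: Rhodes2026, Lemma 3.6 (9) p.6 l.30–45; (36)–(37) p.11 l.70–110] -/
def Lemma36 : Prop :=
  ∃ C₀ : ℝ, 0 < C₀ ∧
    ∀ (ν : ℝ) (u₀ : E3 → E3) (T : ℝ) (u : ℝ → E3 → E3) (p : ℝ → E3 → ℝ), 0 < ν → IsSol ν u₀ T u p →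
      ∀ t₀ ∈ Ico 0 T, ∀ x : E3,
        ‖curl (u t₀) x‖ ≤ C₀ * (enstrophy u t₀) ^ 2 * (logFactor u t₀) ^ 6 / ν ^ 3

/-- **Proposition 4.2 (42) p.13 — iterated Sobolev regularity** «Let ω be a smooth solution of the
vorticity equation (4) on ℝ³ × [0,T] with ν > 0, M := sup_{[0,T]} ‖ω(·,t)‖_{L^∞} < ∞, and E₀ :=
sup_{[0,T]} E(t) < ∞. Then for every integer k ≥ 0: sup_{[0,T]} ‖ω(·,t)‖_{H^k} ≤ P_k(M, E₀, ν, T) ·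
(‖ω₀‖_{H^k} + 1), where P_k is a polynomial in M of degree at most k» — typed (at `k = 3`, the instance
the log closure uses) as: a bound `B(M, E₀, ν, T, ‖ω₀‖_{H³})` on `‖ω(t)‖²_{H³}` along `[0, T']`,
`T' < T`, given a vorticity bound `M` and an enstrophy bound `E₀` there (the polynomial shape is not
typed; TODO(general form): all `k`, degree ≤ `k`). Typist's flag: TRUE-type (parabolic energy
estimates given `‖ω‖_∞ ≤ M`). [claim: Rhodes2026, status: under-review] [cite: Rhodes2026, Prop 4.2 (42)–(43) pp.13–14] -/
def Prop42 : Prop :=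
  ∃ B : ℝ → ℝ → ℝ → ℝ → ℝ → ℝ,
    ∀ (ν : ℝ) (u₀ : E3 → E3) (T : ℝ) (u : ℝ → E3 → E3) (p : ℝ → E3 → ℝ), 0 < ν → IsSol ν u₀ T u p →
      ∀ T' : ℝ, T' < T → ∀ M E₀ : ℝ, (∀ t ∈ Icc 0 T', ∀ y, ‖curl (u t) y‖ ≤ M) →
        (∀ t ∈ Icc 0 T', enstrophy u t ≤ E₀) →
          ∀ t ∈ Icc 0 T', h3NormSq (curl (u t)) ≤ B M E₀ ν T' (h3NormSq (curl u₀))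

/-- **§4 Step 2, (40)–(41) p.13 l.11–28 — linear enstrophy growth** «dE/dt ≤ 2C_CZ M(t) E(t) (40) …
For bounded M, Gronwall gives E(t) ≤ E(0) exp(2C_CZ ∫₀ᵗ M(τ)dτ) (41)» — typed in the integrated form
with a constant vorticity bound `M` on `[0, t]`: `E(t) ≤ E(0) exp(2 C_CZ M t)` (Remark 4.3 (D) p.15
l.5). Typist's flag: TRUE-type (`|∫P| ≤ M‖ω‖²₂ = 2ME`, `L²`-Calderón–Zygmund `‖S‖₂ ≤ ‖∇u‖₂ = ‖ω‖₂`).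
[claim: Rhodes2026, status: under-review] [cite: Rhodes2026, (40)–(41) p.13 l.11–28; Remark 4.3 (D) p.15] -/
def Step_Gronwall41 : Prop :=
  ∃ Ccz : ℝ, 0 < Ccz ∧
    ∀ (ν : ℝ) (u₀ : E3 → E3) (T : ℝ) (u : ℝ → E3 → E3) (p : ℝ → E3 → ℝ), 0 < ν → IsSol ν u₀ T u p →
      ∀ t ∈ Ico 0 T, ∀ M : ℝ, (∀ s ∈ Icc 0 t, ∀ y, ‖curl (u s) y‖ ≤ M) →
        enstrophy u t ≤ enstrophy u 0 * Real.exp (2 * Ccz * M * t)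

/-- **Theorem 4.1, literal face (38) p.12 l.72–p.13 l.2 / Step 4 p.14 l.88–90**: «‖ω(·,t)‖_{L^∞} ≤
M*(t) < ∞ for all t ∈ [0,T*), where M*(t) depends on ‖ω₀‖_{L^∞}, E(0), E₀, ν, and t» read with a
`t`-dependent bound, i.e. «On this interval, M(t) and E(t) are continuous functions of t and hence
bounded on every compact sub-interval [0,T] with T < T_loc»: the vorticity of a solution of the class
is bounded on every CLOSED sub-slab `[0,T'] × ℝ³`, `T' < T`. TRUE in the class — PROVED below
(`theorem41Compact_holds`: Tao 2013 Cor. 11.1 + `W^{2,2} ⊂ C_B`), hence VACUOUS as a step (it holds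
along every solution of the class); the face §5.2 p.15 l.45–48 consumes («≤ M* for all t ∈ [0,T*)»,
«M*(T) < ∞ for every finite T» INCLUDING `T = T_loc`) is `Theorem41`.
[claim: Rhodes2026, status: under-review] [cite: Rhodes2026, Thm 4.1 (38) p.12 l.72–p.13 l.2; Step 4 p.14 l.88–90] -/
def Theorem41Compact : Prop :=
  ∀ (ν : ℝ) (u₀ : E3 → E3) (T : ℝ) (u : ℝ → E3 → E3) (p : ℝ → E3 → ℝ), 0 < ν → IsSol ν u₀ T u p →
    ∀ T' : ℝ, T' < T → ∃ M : ℝ, ∀ t ∈ Icc 0 T', ∀ x, ‖curl (u t) x‖ ≤ M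

/-- **THEOREM 4.1 (38) p.12 l.68–p.13 l.2 as §5.2 consumes it — the uniform a priori vorticity bound** «Let u be a smooth
solution of (1)–(3) on ℝ³ × [0, T*) with ν > 0 and initial energy E₀. Then ‖ω(·,t)‖_{L^∞} ≤ M*(t) < ∞
for all t ∈ [0, T*), where M*(t) depends on ‖ω₀‖_{L^∞}, E(0), E₀, ν, and t» (and Step 4 p.14
l.94–95: «M*(T) < ∞ for every finite T»). Typed as the a priori bound §5.2 consumes: every solution
of the class on a half-open slab `[0, T)` has `|ω|` bounded on `[0, T) × ℝ³`. Summit-strength as a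
hypothesis (tree: `ClayVariants.clayR3_regularity_iff_aprioriVorticityBound`).
[claim: Rhodes2026, status: under-review] [cite: Rhodes2026, Thm 4.1 (38) p.12 l.68–p.13 l.2; Step 4 p.14 l.88–95] -/
def Theorem41 : Prop :=
  ∀ (ν : ℝ) (u₀ : E3 → E3) (T : ℝ) (u : ℝ → E3 → E3) (p : ℝ → E3 → ℝ), 0 < ν → IsSol ν u₀ T u p →
    ∃ M : ℝ, ∀ t ∈ Ico 0 T, ∀ x, ‖curl (u t) x‖ ≤ M

/-- **§4 Step 3 «closing the logarithmic factor», p.13 l.29–33 + (44) p.14 l.61–87 — the printed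
conclusion of Step 3**: «M ≤ C₀(E²/ν³)(C + C_s ln(e + M))⁶. Since the left side grows linearly in M
while the right side grows as (ln M)⁶, this inequality has a finite solution
M ≤ M*(E₀, ‖ω₀‖_{H^s}, ν, t) for every finite E₀. The value M* is determined by the initial data and
ν alone.» Typed with `E₀` as DEFINED where (44) is derived (Prop 4.2 p.13 l.36–37: «E₀ :=
sup_{[0,T]} E(t)», the supremum of the ENSTROPHY on the closed interval) and `s = 3`: one function
`M*` of `(E₀, ‖ω₀‖²_{H³}, ν, T')` bounding `|ω|` on every closed `[0, T'] ⊂ [0, T)` on which the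
enstrophy is `≤ E₀`. Typist's flags: TRUE-type in this reading (vorticity is controlled by an
enstrophy bound — classical `H¹` theory); read with `E₀` = «initial energy E₀» of Thm 4.1 p.12
l.71 / «the conserved energy bound E₀» of p.14 l.66 it is an a priori vorticity bound from the data,
i.e. `Theorem41` itself — the two readings of `E₀` are the referee's call (REF RETYPE v0 (2)).
[claim: Rhodes2026, status: under-review] [cite: Rhodes2026, §4 Step 3 p.13 l.29–33, (44) p.14 l.61–87; Prop 4.2 p.13 l.36–37] -/
def Step3_LogClosure : Prop :=
  ∃ Mstar : ℝ → ℝ → ℝ → ℝ → ℝ,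
    ∀ (ν : ℝ) (u₀ : E3 → E3) (T : ℝ) (u : ℝ → E3 → E3) (p : ℝ → E3 → ℝ), 0 < ν → IsSol ν u₀ T u p →
      ∀ T' : ℝ, T' < T → ∀ E₀ : ℝ, (∀ t ∈ Icc 0 T', enstrophy u t ≤ E₀) →
        ∀ t ∈ Icc 0 T', ∀ x, ‖curl (u t) x‖ ≤ Mstar E₀ (h3NormSq (curl u₀)) ν T'

/-- **§4 Step 1 + Step 3 — the printed inference to the log closure** (p.13 l.3–10 «By Lemma 3.6, at
any time t ∈ [0,T*): M(t) ≤ C₀E(t)²L(t)⁶/ν³ (39)»; p.14 l.61–83 «Proposition 4.2 gives … (44) …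
L ≤ C + C_s ln(e + sup M), and substituting into (39) …»): Lemma 3.6 and Prop 4.2 yield
`Step3_LogClosure`. Typed as the implication itself. [claim: Rhodes2026, status: under-review]
[cite: Rhodes2026, §4 Step 1 (39) p.13 l.3–10; Step 3 p.14 l.61–87] -/
def Step3_Closure : Prop :=
  Lemma36 → Prop42 → Step3_LogClosure

/-- **§4 Step 4 «bootstrap» p.14 l.88–95 with Remark 4.3 (A)–(E) p.14 l.96–p.15 l.9 — the printed
inference from the log closure and (41) to Theorem 4.1** («Steps 1–3 then give: E finite ⇒ M finite
(by Lemma 3.6 and the logarithmic fixed point) ⇒ E bounded by Gronwall over the finite interval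
(Step 2) ⇒ BKM integral ∫₀ᵀ M dt ≤ sup_{[0,T]} M · T < ∞ ⇒ solution extends past T_loc by Theorem
5.1. Iterating: M*(T) < ∞ for every finite T, so T* = ∞»; (C) «the fixed-point equation determines
M*(E, ν)», (D) «E(t) ≤ E(0) exp(2C_CZ M* t)»). Typed as the implication itself: the kernel does not
derive it (`M*` of Step 3 takes the enstrophy bound `E₀` on `[0,T']` as INPUT, (41) bounds the
enstrophy by `M*` — typist's flag: SUSPICIOUS, no bound uniform as `T' ↑ T` is printed; with
`theorem41Compact_holds` below the kernel certifies that everything printed up to here holds on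
closed sub-slabs). [claim: Rhodes2026, status: under-review] [cite: Rhodes2026, §4 Step 4 p.14 l.88–95; Remark 4.3 p.14 l.96–p.15 l.9] -/
def Step4_Bootstrap : Prop :=
  Step3_LogClosure → Step_Gronwall41 → Theorem41

/-- **Theorem 5.1 (45) p.15 — Beale–Kato–Majda** «Let u be a smooth solution of (1)–(3) on ℝ³ × [0, T*)
with maximal existence time T* < ∞. Then ∫₀^{T*} ‖ω(·,t)‖_{L^∞} dt = ∞», typed in the cell's a priori
form for the class: a solution of the class on `[0, T)` whose vorticity is bounded on `[0, T) × ℝ³`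
is NOT maximal — the datum is Clay-solvable or the solution continues (as §5.2 uses it: bounded
vorticity ⇒ «T* = ∞»). TRUE (tree door, see `theorem51_holds`). [claim: Rhodes2026, status: under-review] [cite: Rhodes2026, Thm 5.1 (45) p.15 l.33–41; §5.2 p.15 l.42–51] -/
def Theorem51 : Prop :=
  ∀ ν : ℝ, 0 < ν → ∀ u₀ : E3 → E3, IsDatum u₀ →
    (∀ (T : ℝ) (u : ℝ → E3 → E3) (p : ℝ → E3 → ℝ), IsSol ν u₀ T u p →
        ∃ M : ℝ, ∀ t ∈ Ico 0 T, ∀ x, ‖curl (u t) x‖ ≤ M) →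
      clayR3.Solvable ν 0 u₀

/-- **Proposition 6.1 (46) p.16 — energy identity** «The smooth solution from Theorem 1.1 satisfies
½∫|u(x,t)|² dx + ν∫₀ᵗ∫|∇u|² dx dτ = ½∫|u₀(x)|² dx», typed as the consequence (c) consumes: every
Clay-class solution has `∫|u(t)|² ≤ ∫|u₀|²` for all `t ≥ 0`. TRUE-type (Leray; tree
`isLerayHopfOn_of_finiteEnergy` carries the energy inequality). [claim: Rhodes2026, status: under-review]
[cite: Rhodes2026, Prop 6.1 (46) p.16 l.3–46] -/
def Prop61 : Prop :=
  ∀ ν : ℝ, 0 < ν → ∀ (u₀ : E3 → E3) (u : ℝ → E3 → E3) (p : ℝ → E3 → ℝ), IsDatum u₀ →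
    IsClaySol ν u₀ u p → ∀ t : ℝ, 0 ≤ t → ∫⁻ x, ‖u t x‖ₑ ^ 2 ≤ ∫⁻ x, ‖u₀ x‖ₑ ^ 2

/-! ## Kernel relations -/

/-- The a priori BKM form Theorem 5.1, as §5.2 uses it, HOLDS (tree door: Tao 2013 Cor. 11.1 puts a
finite-energy classical solution from a class-(4) datum in the Beale–Kato–Majda class on closed
sub-slabs, and `ClayVariants.clayR3_regularityAt_iff_aprioriVorticityBound`'s per-datum argument
continues it). [cite: Rhodes2026, Thm 5.1 p.15] [cite: BealeKatoMajda1984, Thm. 1 and Corollary] [cite: Tao2011, Cor. 11.1 (arXiv:1108.1165)] -/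
theorem theorem51_holds : Theorem51 := by
  intro ν hν u₀ hu₀ hbd
  obtain ⟨hsm, hdiv, hdec⟩ := hu₀
  rcases clayR3_solvable_or_supBlowup hν hsm hdiv hdec with
    hsol | ⟨Ts, hTs, u, p, hcl, hu0, hE, -, hmax⟩
  · exact hsol
  · exfalso
    obtain ⟨M, hM⟩ := hbd Ts u p ⟨⟨hsm, hdiv, hdec⟩, hcl, hu0, hE⟩
    have hfin : (∫⁻ t in Ioo 0 Ts, ⨆ x, ‖curl (u t) x‖ₑ) < ⊤ := by
      have hle : (∫⁻ t in Ioo 0 Ts, ⨆ x, ‖curl (u t) x‖ₑ) ≤ ∫⁻ _t in Ioo 0 Ts, ENNReal.ofReal M := by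
        refine setLIntegral_mono' measurableSet_Ioo fun t ht => iSup_le fun x => ?_
        rw [← ofReal_norm]
        exact ENNReal.ofReal_le_ofReal (hM t (Ioo_subset_Ico_self ht) x)
      refine lt_of_le_of_lt hle ?_
      rw [setLIntegral_const]
      exact ENNReal.mul_lt_top ENNReal.ofReal_lt_top measure_Ioo_lt_top
    have hreg := hasBoundedSobolevNormsOn_Icc_of_finiteEnergy_Ico hν hdec hcl hu0 hE
    obtain ⟨T', hT', u', p', hcl', hsob', hagr⟩ := (beale_kato_majda_holds hν.le hTs hcl hreg).2 hfin
    have hcl'' : IsClassicalNSSolutionOn (Icc 0 Ts) ν 0 u' p' :=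
      hcl'.mono (Icc_subset_Ico_right hT') (uniqueDiffOn_Icc hTs)
    have hu'0 : u' 0 = u₀ := (hagr 0 ⟨le_rfl, hTs⟩).trans hu0
    obtain ⟨C, hC⟩ := hsob' 0
    refine hmax Ts le_rfl u' p' hcl'' hu'0 ⟨C, ENNReal.coe_lt_top, fun t ht => ?_⟩
    have h := hC t ht
    have h2 : ∀ x, ‖iteratedFDeriv ℝ 0 (u' t) x‖ₑ = ‖u' t x‖ₑ := fun x =>
      enorm_eq_iff_norm_eq.2 norm_iteratedFDeriv_zero
    simp_rw [h2] at h
    exact h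

/-- **Step 0 HOLDS** (local existence in the class: the blow-up alternative gives a solution of the
class on some `[0, T)`, `T > 0`, in either branch). [cite: Rhodes2026, §5.2 p.15 l.43–44] [cite: Tao2011, Thm. 5.4, Lemma 8.1 (arXiv:1108.1165)] -/
theorem step0_holds : Step0_LocalExistence := by
  intro ν hν u₀ hu₀
  obtain ⟨hsm, hdiv, hdec⟩ := hu₀
  rcases clayR3_solvable_or_supBlowup hν hsm hdiv hdec with
    ⟨u, p, hu, hp, hns, hE⟩ | ⟨Ts, hTs, u, p, hcl, hu0, hE, -, -⟩
  · refine ⟨1, one_pos, u, p, ⟨⟨hsm, hdiv, hdec⟩, ?_, hns.initial, ?_⟩⟩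
    · exact (hns.isClassicalNSSolutionOn_Icc hu hp one_pos).mono Ico_subset_Icc_self
        (uniqueDiffOn_Ico 0 1)
    · obtain ⟨C, hC, hb⟩ := hE
      exact ⟨C, hC, fun t ht => hb t ht.1⟩
  · exact ⟨Ts, hTs, u, p, ⟨⟨hsm, hdiv, hdec⟩, hcl, hu0, hE⟩⟩

/-- **Theorem 4.1 ⇒ Clay (A)** — §5.2 p.15 l.43–51 in the kernel: the a priori vorticity bound of
Theorem 4.1 for the class IS the hypothesis of the tree's door
`ClayVariants.clayR3_regularity_iff_aprioriVorticityBound` (blow-up alternative + Beale–Kato–Majda).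
[cite: Rhodes2026, §5.2 p.15 l.43–51] [cite: BealeKatoMajda1984, Thm. 1 and Corollary] -/
theorem clayA_of_theorem41 (h41 : Theorem41) : clayR3.Regularity :=
  clayR3_regularity_iff_aprioriVorticityBound.2 fun ν hν u₀ hsm hdiv hdec T u p hcl hu0 hE =>
    h41 ν u₀ T u p hν ⟨⟨hsm, hdiv, hdec⟩, hcl, hu0, hE⟩

/-- **Thm 1.1 (d) HOLDS (kernel)** — uniqueness among smooth bounded-energy solutions from a Clay
datum (§7 p.16): at `t = 0` both are the datum; for `t > 0` the second solution is a finite energy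
classical solution on `[0, t]`, hence Leray–Hopf (Tao 2013 Lemma 8.1, `isLerayHopfOn_of_finiteEnergy`),
so it agrees a.e. with the first one (Cor. 11.1 + Prodi–Serrin, `IsNavierStokesSolution.ae_eq_of_isLerayHopfOn`),
and continuous slices agreeing a.e. agree. (The printed route — (47), Ladyzhenskaya + Grönwall with
`∫‖∇u₂‖⁴ < ∞` from Thm 4.1 — is not followed; the statement is classical.)
[cite: Rhodes2026, §7 (47) p.16 l.47–114] [cite: Tao2011, Lemma 8.1 and Cor. 11.1 (arXiv:1108.1165)] -/
theorem uniquenessD_holds : UniquenessD := by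
  intro ν hν u₀ hu₀ u₁ p₁ u₂ p₂ h₁ h₂ t ht
  obtain ⟨hU₁, hP₁, hns₁, hE₁⟩ := h₁
  obtain ⟨hU₂, hP₂, hns₂, hE₂⟩ := h₂
  rcases ht.eq_or_lt with rfl | ht0
  · rw [hns₁.initial, hns₂.initial]
  have hcl₂ : IsClassicalNSSolutionOn (Icc 0 t) ν 0 u₂ p₂ := hns₂.isClassicalNSSolutionOn_Icc hU₂ hP₂ ht0
  have hfe₂ : ∃ A : ℝ≥0∞, A < ⊤ ∧ ∀ s ∈ Icc 0 t, ∫⁻ x, ‖u₂ s x‖ₑ ^ 2 ≤ A := by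
    obtain ⟨C, hC, hb⟩ := hE₂
    exact ⟨C, hC, fun s hs => hb s hs.1⟩
  have hLH₂ : IsLerayHopfOn t ν 0 u₀ u₂ := by
    have h := (isLerayHopfOn_of_finiteEnergy hcl₂ hν ht0 hfe₂).1
    rwa [hns₂.initial] at h
  have hae : u₂ t =ᵐ[volume] u₁ t :=
    hns₁.ae_eq_of_isLerayHopfOn hν ht0 hu₀.2.2 hU₁ hP₁ hE₁ hLH₂ t ⟨ht0, le_rfl⟩
  have hc₁ : Continuous (u₁ t) :=
    (IsSmoothSpaceTimeOn.contDiff_slice (S := Ici 0) (w := u₁) hU₁ ht).continuous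
  have hc₂ : Continuous (u₂ t) :=
    (IsSmoothSpaceTimeOn.contDiff_slice (S := Ici 0) (w := u₂) hU₂ ht).continuous
  exact ((Continuous.ae_eq_iff_eq volume hc₂ hc₁).1 hae).symm

/-- **Theorem 4.1's literal / compact-sub-slab face HOLDS in the class** (so it cannot carry the
argument): on `[0,T']`, `T' < T`, a finite-energy classical solution from a class-(4) datum has all
`L²` Sobolev norms bounded (Tao 2013 Cor. 11.1, tree `hasBoundedSobolevNormsOn_Icc_of_finiteEnergy_Ico`),
and `W^{2,2}(ℝ³) ⊂ C_B(ℝ³)` bounds `curl u` there (`exists_enorm_curl_le_of_hasBoundedSobolevNormsOn`).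
[cite: Rhodes2026, Step 4 p.14 l.88–90] [cite: Tao2011, Cor. 11.1 (arXiv:1108.1165)] [cite: Adams1975, Thm. 5.4 Part I Case C] -/
theorem theorem41Compact_holds : Theorem41Compact := by
  intro ν u₀ T u p hν hs T' hT'
  have hB := hasBoundedSobolevNormsOn_Icc_of_finiteEnergy_Ico hν hs.datum.2.2 hs.classical hs.initial
    hs.energy T' hT'
  have hsm : ∀ t ∈ Icc 0 T', ContDiff ℝ ∞ (u t) := fun t ht =>
    hs.classical.smooth_velocity.contDiff_slice ⟨ht.1, ht.2.trans_lt hT'⟩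
  obtain ⟨R, hR, hb⟩ := exists_enorm_curl_le_of_hasBoundedSobolevNormsOn hsm hB
  refine ⟨R.toReal, fun t ht x => ?_⟩
  have h := hb t ht x
  rw [← ofReal_norm] at h
  exact (ENNReal.ofReal_le_iff_le_toReal hR.ne).1 h

/-- **Prop 6.1 ⇒ (c) HOLDS (kernel)** for every Clay-class solution: on `[0,t]` it is a finite-energy
classical solution, hence Leray–Hopf (Tao 2013 Lemma 8.1, `isLerayHopfOn_of_finiteEnergy`), whose
energy inequality with `f ≡ 0` reads `½∫|u(t)|² + ν∫∫|∇u|² ≤ ½∫|u₀|²`.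
[cite: Rhodes2026, Prop 6.1 (46) p.16 l.3–46] [cite: Tao2011, Lemma 8.1 (arXiv:1108.1165)] -/
theorem prop61_holds : Prop61 := by
  intro ν hν u₀ u p _hu₀ hsol t ht
  obtain ⟨hU, hP, hns, hE⟩ := hsol
  rcases ht.eq_or_lt with rfl | ht0
  · rw [hns.initial]
  have hcl : IsClassicalNSSolutionOn (Icc 0 t) ν 0 u p := hns.isClassicalNSSolutionOn_Icc hU hP ht0
  have hfe : ∃ A : ℝ≥0∞, A < ⊤ ∧ ∀ s ∈ Icc 0 t, ∫⁻ x, ‖u s x‖ₑ ^ 2 ≤ A := by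
    obtain ⟨C, hC, hb⟩ := hE
    exact ⟨C, hC, fun s hs => hb s hs.1⟩
  have hLH : IsLerayHopfOn t ν 0 (u 0) u := (isLerayHopfOn_of_finiteEnergy hcl hν ht0 hfe).1
  obtain ⟨G, -, -, hEI, -⟩ := hLH.weakGrad_energy
  have ht' : t ∈ Icc 0 t := ⟨ht, le_rfl⟩
  have h0' : (0 : ℝ) ∈ Icc 0 t := ⟨le_rfl, ht⟩
  have hineq := hEI t ht'
  simp only [Pi.zero_apply, inner_zero_left, integral_zero, intervalIntegral.integral_zero,
    add_zero] at hineq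
  have hdiss : 0 ≤ ν * (∫⁻ τ in Ioo 0 t, ∫⁻ x, ENNReal.ofReal (frobeniusNormSq (G τ x))).toReal :=
    mul_nonneg hν.le ENNReal.toReal_nonneg
  have hKE : VectorCalculus.kineticEnergy (u t) ≤ VectorCalculus.kineticEnergy (u 0) := by linarith
  have h1 : eEnergy (u t) = ENNReal.ofReal (2 * VectorCalculus.kineticEnergy (u t)) := hLH.eEnergy_eq ht'
  have h2 : eEnergy (u 0) = ENNReal.ofReal (2 * VectorCalculus.kineticEnergy (u 0)) :=
    hLH.eEnergy_eq h0'
  change eEnergy (u t) ≤ eEnergy u₀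
  rw [← hns.initial, h1, h2]
  exact ENNReal.ofReal_le_ofReal (by linarith)

/-- **The printed sub-chain to Theorem 4.1 composes by definition of `Step3_Closure` and
`Step4_Bootstrap`** (Remark 4.3 (A)–(E)): Lemma 3.6 and Prop 4.2 give the log closure, which with (41)
and the bootstrap inference gives Theorem 4.1. Pure logic. [cite: Rhodes2026, Remark 4.3 p.14 l.96–p.15 l.9] -/
theorem theorem41_of_printed (h36 : Lemma36) (h42 : Prop42) (hS3 : Step3_Closure)
    (h41g : Step_Gronwall41) (hS4 : Step4_Bootstrap) : Theorem41 :=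
  hS4 (hS3 h36 h42) h41g

/-- **COMPOSITION (p.3 l.55–60 «five steps»; §5.2 p.15; §6; §7)**: Theorem 4.1 ALONE gives
Thm 1.1 (a)–(d) in the kernel — (a)(b) and bounded energy through the tree's BKM door
(`clayA_of_theorem41`), (c) by `prop61_holds`, (d) by `uniquenessD_holds`. PROVED; so the claim
reduces in the kernel to the single hypothesis `Theorem41` (⇐ `Lemma36`, `Prop42`, `Step3_Closure`,
`Step_Gronwall41`, `Step4_Bootstrap` as printed: `claim_of_printed_steps`).
[cite: Rhodes2026, Thm 1.1 proof outline p.3 l.55–60; §5.2 p.15 l.42–71] -/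
theorem claim_of_steps (h41 : Theorem41) : ClaimedTheorem := by
  refine ⟨fun ν hν u₀ hu₀ => ?_, uniquenessD_holds⟩
  obtain ⟨u, p, hu, hp, hns, hE⟩ := clayA_of_theorem41 h41 ν hν u₀ hu₀.1 hu₀.2.1 hu₀.2.2
  exact ⟨u, p, hu, hp, hns, prop61_holds ν hν u₀ u p hu₀ ⟨hu, hp, hns, hE⟩⟩

/-- The full printed chain: Lemma 3.6 → Prop 4.2 → (39)/(44) log closure → (41) → bootstrap →
Thm 4.1 → BKM/§5.2 → §6 → §7 → Thm 1.1. [cite: Rhodes2026, p.3 l.55–60; Remark 4.3 p.14–15] -/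
theorem claim_of_printed_steps (h36 : Lemma36) (h42 : Prop42) (hS3 : Step3_Closure)
    (h41g : Step_Gronwall41) (hS4 : Step4_Bootstrap) : ClaimedTheorem :=
  claim_of_steps (theorem41_of_printed h36 h42 hS3 h41g hS4)

/-! ## The Clay link (cell TYPING-HYGIENE 10(a)) -/

/-- A Clay datum has finite energy. [cite: Tao2011, Cor. 11.1 (arXiv:1108.1165)] -/
private theorem lintegral_sq_lt_top_of_isDatum {u₀ : E3 → E3} (h : IsDatum u₀) :
    ∫⁻ x, ‖u₀ x‖ₑ ^ 2 < ⊤ := by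
  have h0 := sobolevDatum_of_rapidDecay h.2.2 0
  have h2 : ∀ x, ‖iteratedFDeriv ℝ 0 u₀ x‖ₑ = ‖u₀ x‖ₑ := fun x =>
    enorm_eq_iff_norm_eq.2 norm_iteratedFDeriv_zero
  simp_rw [h2] at h0
  exact h0

/-- **CLAY LINK, PROVED**: the claimed theorem implies Clay (A) (`ClayVariants.clayR3.Regularity`) — a
projection ((c) with `C := ∫|u₀|² < ∞` gives (7)); no wrong-problem axis.
[cite: Rhodes2026, Thm 1.1 p.3; §1.1 p.3 l.4–13] [cite: FeffermanClay2006, (A) p. 2] -/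
theorem clay_of_claimed (h : ClaimedTheorem) : clayR3.Regularity := by
  intro ν hν u₀ hsm hdiv hdec
  obtain ⟨u, p, hu, hp, hns, hc⟩ := h.1 ν hν u₀ ⟨hsm, hdiv, hdec⟩
  exact ⟨u, p, hu, hp, hns, ⟨∫⁻ x, ‖u₀ x‖ₑ ^ 2, lintegral_sq_lt_top_of_isDatum ⟨hsm, hdiv, hdec⟩, hc⟩⟩

/-- With Theorem 4.1 alone the kernel already reaches the summit statement (A) (`clayA_of_theorem41`);
recorded for the lead (escalation grade of an eventual ALL-STEPS-RESIST on `Lemma36`/`Step4_Bootstrap`).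
[cite: Rhodes2026, Thm 4.1 p.12; §5.2 p.15] -/
theorem clayA_of_printed (h36 : Lemma36) (h42 : Prop42) (hS3 : Step3_Closure)
    (h41g : Step_Gronwall41) (hS4 : Step4_Bootstrap) : clayR3.Regularity :=
  clayA_of_theorem41 (theorem41_of_printed h36 h42 hS3 h41g hS4)

/-! ## D-0026 debt pass (typist-1 g5, 2026-08-27): TRUE-type Steps certified in the kernel

Append-only: `step1_superharmonic11_holds` ((10)–(11) p.6) and `theorem31_holds` (Thm 3.1 (ii)
pp.4–5). Neither is on the load of the printed chain (`Lemma36` / (12)–(13) / `Step4_Bootstrap`);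
no statement above is touched. -/

section Step1Proof

/-- Directional second-order condition at a global maximum `x₀` of `|V|` for a `C²` field, strong form:
`⟪V(x₀), ∂ₑ∂ₑV(x₀)⟫ + |∂ₑV(x₀)|² ≤ 0` (the restriction `s ↦ |V(x₀ + s e)|²` has a maximum at `0`, so
its second derivative `2⟪V,∂ₑ∂ₑV⟫ + 2|∂ₑV|²` is `≤ 0`; (10) along `e`). [cite: Rhodes2026, (10)–(11) p.6 l.53–62] -/
private theorem inner_fderiv_fderiv_add_sq_nonpos {V : E3 → E3} (hV2 : ContDiff ℝ 2 V) {x₀ : E3}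
    (hmax : ∀ x, ‖V x‖ ≤ ‖V x₀‖) (e : E3) :
    ⟪V x₀, fderiv ℝ (fun y => fderiv ℝ V y e) x₀ e⟫ + ‖fderiv ℝ V x₀ e‖ ^ 2 ≤ 0 := by
  set W : E3 → E3 := fun y => fderiv ℝ V y e with hW
  have hVd : ∀ y, HasFDerivAt V (fderiv ℝ V y) y := fun y =>
    (hV2.differentiable (by simp) y).hasFDerivAt
  have hW1 : ContDiff ℝ 1 W := (hV2.fderiv_right (m := 1) le_rfl).clm_apply contDiff_const
  have hWd : ∀ y, HasFDerivAt W (fderiv ℝ W y) y := fun y =>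
    (hW1.differentiable one_ne_zero y).hasFDerivAt
  -- the line `p s = x₀ + s e`
  let p : ℝ → E3 := fun s => x₀ + s • e
  have hp0 : p 0 = x₀ := by simp [p]
  have hpd : ∀ s, HasDerivAt p e s := fun s => by
    show HasDerivAt (fun s : ℝ => x₀ + s • e) e s
    simpa using ((hasDerivAt_id s).smul_const e).const_add x₀
  have hVp : ∀ s, HasDerivAt (fun s => V (p s)) (W (p s)) s := fun s => by
    have := (hVd (p s)).comp_hasDerivAt s (hpd s)
    simpa [hW, Function.comp_def] using this
  have hWp : ∀ s, HasDerivAt (fun s => W (p s)) (fderiv ℝ W (p s) e) s := fun s => by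
    have := (hWd (p s)).comp_hasDerivAt s (hpd s)
    simpa [Function.comp_def] using this
  -- `ℓ(s) = |V(p s)|²` and its first two derivatives
  set ℓ : ℝ → ℝ := fun s => ⟪V (p s), V (p s)⟫ with hℓ
  have hℓd : ∀ s, HasDerivAt ℓ (2 * ⟪V (p s), W (p s)⟫) s := fun s => by
    refine ((hVp s).inner ℝ (hVp s)).congr_deriv ?_
    rw [real_inner_comm (W (p s)), two_mul]
  have hderiv : deriv ℓ = fun s => 2 * ⟪V (p s), W (p s)⟫ := funext fun s => (hℓd s).deriv
  have hℓdd : ∀ s, HasDerivAt (fun s => 2 * ⟪V (p s), W (p s)⟫)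
      (2 * (⟪V (p s), fderiv ℝ W (p s) e⟫ + ⟪W (p s), W (p s)⟫)) s := fun s =>
    ((hVp s).inner ℝ (hWp s)).const_mul 2
  have hderiv2 : deriv (deriv ℓ) 0 = 2 * (⟪V x₀, fderiv ℝ W x₀ e⟫ + ⟪W x₀, W x₀⟫) := by
    rw [hderiv, (hℓdd 0).deriv, hp0]
  -- first-order condition `⟪V(x₀), ∂ₑV(x₀)⟫ = 0`
  have hsq : ∀ x, ‖V x‖ ^ 2 ≤ ‖V x₀‖ ^ 2 := fun x => pow_le_pow_left₀ (norm_nonneg _) (hmax x) 2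
  have h1st : ⟪V x₀, fderiv ℝ V x₀ e⟫ = 0 := by
    have hloc2 : IsLocalMax (fun x => ‖V x‖ ^ 2) x₀ := Filter.Eventually.of_forall hsq
    have hd := (hV2.differentiable (by simp) x₀).hasFDerivAt.norm_sq
    have h0 := hloc2.hasFDerivAt_eq_zero hd
    have h1 := congrArg (fun L : E3 →L[ℝ] ℝ => L e) h0
    simpa using h1
  have hderiv1 : deriv ℓ 0 = 0 := by
    rw [hderiv]
    simp only [hp0, hW]
    rw [h1st, mul_zero]
  have hℓmax : IsLocalMax ℓ 0 := Filter.Eventually.of_forall fun s => by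
    simp only [hℓ, real_inner_self_eq_norm_sq, hp0]
    exact hsq _
  -- second-order condition: `ℓ''(0) ≤ 0` (else `0` is also a strict local minimum and `ℓ` is
  -- locally constant with vanishing second derivative)
  have h2nd : deriv (deriv ℓ) 0 ≤ 0 := le_of_not_gt fun hcon => by
    have hℓmin : IsLocalMin ℓ 0 := isLocalMin_of_deriv_deriv_pos hcon hderiv1 (hℓd 0).continuousAt
    have hconst : ∀ᶠ s in 𝓝 (0 : ℝ), ℓ s = ℓ 0 :=
      (hℓmin.and hℓmax).mono fun s hs => le_antisymm hs.2 hs.1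
    have hd0 : deriv ℓ =ᶠ[𝓝 (0 : ℝ)] fun _ => (0 : ℝ) := by
      filter_upwards [hconst.eventually_nhds] with s hs
      have h1 : ℓ =ᶠ[𝓝 s] fun _ => ℓ 0 := hs
      rw [h1.deriv_eq, deriv_const]
    have : deriv (deriv ℓ) 0 = 0 := by rw [hd0.deriv_eq, deriv_const]
    linarith
  rw [hderiv2] at h2nd
  have hWW : ⟪W x₀, W x₀⟫ = ‖fderiv ℝ V x₀ e‖ ^ 2 := real_inner_self_eq_norm_sq _
  linarith

/-- `ΔG(x) = Σᵢ ∂_{bᵢ}(∂_{bᵢ}G)(x)` along an orthonormal basis. [folklore] -/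
private theorem laplacian_eq_sum_fderiv_fderiv_dir {G : E3 → E3} {x : E3}
    (hG : DifferentiableAt ℝ (fderiv ℝ G) x) {ι : Type*} [Fintype ι] (b : OrthonormalBasis ι ℝ E3) :
    (Δ G) x = ∑ i, fderiv ℝ (fun y => fderiv ℝ G y (b i)) x (b i) := by
  rw [congrFun (InnerProductSpace.laplacian_eq_iteratedFDeriv_orthonormalBasis G b) x]
  refine Finset.sum_congr rfl fun i _ => ?_
  rw [iteratedFDeriv_two_apply, fderiv_clm_apply hG (differentiableAt_const _)]
  simp

/-- **Step 1 of the proof of Lemma 3.6, (10)–(11) p.6, HOLDS (kernel)** for every `C²` field at a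
global maximum of its modulus: summing the directional second-order conditions
`⟪w,∂ᵢ∂ᵢw⟫ + |∂ᵢw|² ≤ 0` over the standard basis gives `|∇w(x₀)|² ≤ −w(x₀)·Δw(x₀)`, and
Cauchy–Schwarz gives `−w·Δw ≤ |w||Δw|`. [cite: Rhodes2026, (10)–(11) p.6 l.53–62] -/
theorem step1_superharmonic11_holds : Step1_Superharmonic11 := by
  intro w x₀ hw hmax
  refine ⟨?_, (neg_le_abs _).trans (abs_real_inner_le_norm _ _)⟩
  have hG : DifferentiableAt ℝ (fderiv ℝ w) x₀ :=
    ((hw.fderiv_right (m := 1) le_rfl).differentiable one_ne_zero).differentiableAt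
  set b := EuclideanSpace.basisFun (Fin 3) ℝ with hb
  have hΔ := laplacian_eq_sum_fderiv_fderiv_dir hG b
  have hsum : ∑ i : Fin 3, (⟪w x₀, fderiv ℝ (fun y => fderiv ℝ w y (b i)) x₀ (b i)⟫ +
      ‖fderiv ℝ w x₀ (b i)‖ ^ 2) ≤ 0 :=
    Finset.sum_nonpos fun i _ => inner_fderiv_fderiv_add_sq_nonpos hw hmax _
  rw [Finset.sum_add_distrib, ← inner_sum, ← hΔ] at hsum
  have hgs : gradSq w x₀ = ∑ i : Fin 3, ‖fderiv ℝ w x₀ (b i)‖ ^ 2 := by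
    refine Finset.sum_congr rfl fun i _ => ?_
    rw [hb, EuclideanSpace.basisFun_apply]
  linarith

end Step1Proof

section Theorem31Proof

/-- `|∇(curl v)(x)|² ≤ 3‖curlCLM‖² ‖D²v(x)‖²` for `v ∈ C³`. [folklore] -/
private theorem gradSq_curl_le {v : E3 → E3} (hv : ContDiff ℝ 3 v) (x : E3) :
    gradSq (curl v) x ≤ 3 * (‖curlCLM‖ ^ 2 * ‖iteratedFDeriv ℝ 2 v x‖ ^ 2) := by
  have h1 : ∀ i : Fin 3, ‖fderiv ℝ (curl v) x (EuclideanSpace.single i (1 : ℝ))‖ ^ 2 ≤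
      ‖curlCLM‖ ^ 2 * ‖iteratedFDeriv ℝ 2 v x‖ ^ 2 := by
    intro i
    have hle : ‖fderiv ℝ (curl v) x (EuclideanSpace.single i (1 : ℝ))‖ ≤
        ‖curlCLM‖ * ‖iteratedFDeriv ℝ 2 v x‖ := by
      calc ‖fderiv ℝ (curl v) x (EuclideanSpace.single i (1 : ℝ))‖
          ≤ ‖fderiv ℝ (curl v) x‖ * ‖EuclideanSpace.single i (1 : ℝ)‖ :=
            ContinuousLinearMap.le_opNorm _ _
        _ = ‖iteratedFDeriv ℝ 1 (curl v) x‖ := by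
            rw [norm_iteratedFDeriv_one]; simp
        _ ≤ ‖curlCLM‖ * ‖iteratedFDeriv ℝ 2 v x‖ :=
            norm_iteratedFDeriv_curl_le_opNorm_mul hv 1 (by norm_cast) x
    calc ‖fderiv ℝ (curl v) x (EuclideanSpace.single i (1 : ℝ))‖ ^ 2
        ≤ (‖curlCLM‖ * ‖iteratedFDeriv ℝ 2 v x‖) ^ 2 := pow_le_pow_left₀ (norm_nonneg _) hle 2
      _ = ‖curlCLM‖ ^ 2 * ‖iteratedFDeriv ℝ 2 v x‖ ^ 2 := by ring
  calc gradSq (curl v) x = ∑ i : Fin 3, ‖fderiv ℝ (curl v) x (EuclideanSpace.single i (1 : ℝ))‖ ^ 2 := rfl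
    _ ≤ ∑ _i : Fin 3, ‖curlCLM‖ ^ 2 * ‖iteratedFDeriv ℝ 2 v x‖ ^ 2 := Finset.sum_le_sum fun i _ => h1 i
    _ = 3 * (‖curlCLM‖ ^ 2 * ‖iteratedFDeriv ℝ 2 v x‖ ^ 2) := by
        rw [Finset.sum_const, Finset.card_univ, Fintype.card_fin]; simp

/-- A linear map on `ℝ³` vanishing on the standard basis vanishes. [folklore] -/
private theorem clm_eq_zero_of_apply_single {F : Type*} [NormedAddCommGroup F] [NormedSpace ℝ F]
    (L : E3 →L[ℝ] F) (h : ∀ i : Fin 3, L (EuclideanSpace.single i (1 : ℝ)) = 0) : L = 0 := by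
  refine ContinuousLinearMap.ext fun v => ?_
  have hv : v = ∑ i : Fin 3, v i • EuclideanSpace.single i (1 : ℝ) := by
    have := (EuclideanSpace.basisFun (Fin 3) ℝ).sum_repr v
    simpa [EuclideanSpace.basisFun_apply] using this.symm
  rw [hv, map_sum]
  simp [map_smul, h]

/-- **Theorem 3.1 (ii) HOLDS in the class (kernel)**: for a solution of the class and `t ∈ [0,T)`,
`∫ D dx = 0 ⇔ ω(·,t) ≡ 0`. (⇒) `D = ν|∇ω|²` is continuous, nonnegative and integrable (Tao 2013
Cor. 11.1: `‖D²u(t)‖ ∈ L²`), so it vanishes identically, `∇ω ≡ 0`, and an `L²` field on `ℝ³` with zero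
derivative is `0` (`eq_of_fderiv_eq_of_lintegral_sq_lt_top`); (⇐) trivial. The printed proof's
«constant nonzero ω has infinite energy» is replaced by «ω(t) ∈ L²(ℝ³)», same conclusion.
[cite: Rhodes2026, Thm 3.1 (ii) p.4 l.52–54, proof p.4 l.61–p.5 l.15] [cite: Tao2011, Cor. 11.1 (arXiv:1108.1165)] -/
theorem theorem31_holds : Theorem31 := by
  intro ν u₀ T u p hν hs t ht
  have hsm : ContDiff ℝ ∞ (u t) := hs.classical.smooth_velocity.contDiff_slice ht
  have hs3 : ContDiff ℝ 3 (u t) := hsm.of_le (by norm_cast)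
  have hω2 : ContDiff ℝ 2 (curl (u t)) := by
    rw [curl_eq_curlCLM_comp]
    exact curlCLM.contDiff.comp (hs3.fderiv_right (m := 2) (by norm_cast))
  have hnonneg : ∀ x, 0 ≤ dissipation ν (u t) x := fun x =>
    mul_nonneg hν.le (Finset.sum_nonneg fun i _ => sq_nonneg _)
  have hcont : Continuous (dissipation ν (u t)) := by
    have hc : Continuous (fderiv ℝ (curl (u t))) := hω2.continuous_fderiv (by norm_cast)
    unfold dissipation gradSq
    exact continuous_const.mul
      (continuous_finsetSum _ fun i _ => ((hc.clm_apply continuous_const).norm).pow 2)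
  constructor
  · intro hint x
    have htI : t ∈ Icc 0 t := ⟨ht.1, le_rfl⟩
    have hB := hasBoundedSobolevNormsOn_Icc_of_finiteEnergy_Ico hν hs.datum.2.2 hs.classical
      hs.initial hs.energy t ht.2
    obtain ⟨C₁, hC₁⟩ := hB 1
    obtain ⟨C₂, hC₂⟩ := hB 2
    -- `‖D²u(t)‖² ∈ L¹`
    have hD2int : Integrable (fun x => ‖iteratedFDeriv ℝ 2 (u t) x‖ ^ 2) := by
      refine ⟨((hsm.continuous_iteratedFDeriv (by norm_cast)).norm.pow 2).aestronglyMeasurable, ?_⟩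
      refine (hasFiniteIntegral_iff_enorm).2
        (lt_of_le_of_lt (le_of_eq ?_) ((hC₂ t htI).trans_lt ENNReal.coe_lt_top))
      refine lintegral_congr fun x => ?_
      rw [Real.enorm_eq_ofReal (sq_nonneg _), ← ofReal_norm, ENNReal.ofReal_pow (norm_nonneg _)]
    -- hence `D` is integrable
    have hint' : Integrable (dissipation ν (u t)) := by
      refine (hD2int.const_mul (ν * (3 * ‖curlCLM‖ ^ 2))).mono' hcont.aestronglyMeasurable
        (Eventually.of_forall fun x => ?_)
      rw [Real.norm_of_nonneg (hnonneg x)]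
      calc dissipation ν (u t) x ≤ ν * (3 * (‖curlCLM‖ ^ 2 * ‖iteratedFDeriv ℝ 2 (u t) x‖ ^ 2)) :=
            mul_le_mul_of_nonneg_left (gradSq_curl_le hs3 x) hν.le
        _ = ν * (3 * ‖curlCLM‖ ^ 2) * ‖iteratedFDeriv ℝ 2 (u t) x‖ ^ 2 := by ring
    -- `∫ D = 0`, `D ≥ 0` continuous integrable ⇒ `D ≡ 0`
    have hae : dissipation ν (u t) =ᵐ[volume] 0 :=
      (integral_eq_zero_iff_of_nonneg (fun x => hnonneg x) hint').1 hint
    have hzero : ∀ y, dissipation ν (u t) y = 0 := fun y =>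
      congrFun ((Continuous.ae_eq_iff_eq volume hcont continuous_const).1 hae) y
    -- `∇ω ≡ 0`
    have hfd : ∀ y, fderiv ℝ (curl (u t)) y = 0 := by
      intro y
      have hsum : ∑ i : Fin 3, ‖fderiv ℝ (curl (u t)) y (EuclideanSpace.single i (1 : ℝ))‖ ^ 2 = 0 := by
        have h := hzero y
        unfold dissipation gradSq at h
        rcases mul_eq_zero.1 h with h | h
        · exact absurd h hν.ne'
        · exact h
      refine clm_eq_zero_of_apply_single _ fun i => ?_
      have hi := (Finset.sum_eq_zero_iff_of_nonneg fun i _ => sq_nonneg _).1 hsum i (Finset.mem_univ i)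
      exact norm_eq_zero.1 ((pow_eq_zero_iff two_ne_zero).1 hi)
    -- `ω(t) ∈ L²`
    have hL2 : ∫⁻ y, ‖curl (u t) y‖ₑ ^ 2 < ⊤ := by
      have hle : ∀ y, ‖curl (u t) y‖ₑ ^ 2 ≤
          ENNReal.ofReal (‖curlCLM‖ ^ 2) * ‖iteratedFDeriv ℝ 1 (u t) y‖ₑ ^ 2 := by
        intro y
        have h := norm_curl_le (u t) y
        rw [← norm_iteratedFDeriv_one] at h
        calc ‖curl (u t) y‖ₑ ^ 2 = ENNReal.ofReal (‖curl (u t) y‖ ^ 2) := by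
              rw [← ofReal_norm, ENNReal.ofReal_pow (norm_nonneg _)]
          _ ≤ ENNReal.ofReal ((‖curlCLM‖ * ‖iteratedFDeriv ℝ 1 (u t) y‖) ^ 2) :=
              ENNReal.ofReal_le_ofReal (pow_le_pow_left₀ (norm_nonneg _) h 2)
          _ = ENNReal.ofReal (‖curlCLM‖ ^ 2) * ‖iteratedFDeriv ℝ 1 (u t) y‖ₑ ^ 2 := by
              rw [mul_pow, ENNReal.ofReal_mul (sq_nonneg _), ← ofReal_norm (iteratedFDeriv ℝ 1 (u t) y),
                ENNReal.ofReal_pow (norm_nonneg _)]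
      calc ∫⁻ y, ‖curl (u t) y‖ₑ ^ 2
          ≤ ∫⁻ y, ENNReal.ofReal (‖curlCLM‖ ^ 2) * ‖iteratedFDeriv ℝ 1 (u t) y‖ₑ ^ 2 := lintegral_mono hle
        _ = ENNReal.ofReal (‖curlCLM‖ ^ 2) * ∫⁻ y, ‖iteratedFDeriv ℝ 1 (u t) y‖ₑ ^ 2 :=
            lintegral_const_mul' _ _ ENNReal.ofReal_ne_top
        _ < ⊤ := ENNReal.mul_lt_top ENNReal.ofReal_lt_top ((hC₁ t htI).trans_lt ENNReal.coe_lt_top)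
    have hdiff : Differentiable ℝ (curl (u t)) := hω2.differentiable (by norm_cast)
    have heq := eq_of_fderiv_eq_of_lintegral_sq_lt_top hdiff (differentiable_const (0 : E3))
      (fun y => by rw [hfd y]; simp) hL2 (by simp)
    exact congrFun heq x
  · intro h0
    have hω0 : curl (u t) = fun _ => (0 : E3) := funext h0
    simp [dissipation, gradSq, hω0]

end Theorem31Proof

/-! ## D-0026 debt pass (ns-claims-typist-7 g6, cross-lineage, post-row; split with the typist of
record ns-claims-typist-1 g5 09:47:09Z): the TRUE-type context steps `Step2_MaxIdentities` and
`Step_Gronwall41` HOLD in the class. Records-grade: neither is a locator (VERDICT C142: `Lemma36`);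
append-only, nothing above is touched. -/

/-- Smoothness of the vorticity slice of a smooth field. [folklore] -/
private theorem contDiff_infty_curl_slice {v : E3 → E3} (hv : ContDiff ℝ ∞ v) : ContDiff ℝ ∞ (curl v) :=
  contDiff_curl (n := ⊤) (by simpa using hv)

/-- The half-open slab lies in the closure of its interior (`0 < T`). [folklore] -/
private theorem Ico_zero_subset_closure_interior {T : ℝ} (hT : 0 < T) :
    Ico (0 : ℝ) T ⊆ closure (interior (Ico (0 : ℝ) T)) := by
  rw [interior_Ico, closure_Ioo hT.ne]
  exact Ico_subset_Icc_self

/-- **Step 2 (a)–(b) of the proof of Lemma 3.6, p.6 l.63–90, HOLDS**: at a spatial maximum `x₀` of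
`|ω(·,t₀)|` along a solution of the class, `⟪ω, (u·∇)ω⟫(x₀) = 0` (first-order condition:
`∇|ω|²(x₀) = 0`) and `⟪ω, ∂ₜω⟫(x₀) = ν⟪ω, Δω⟫(x₀) + P(x₀) ≤ P(x₀)` (the tree's vorticity equation
`∂ₜω + (u·∇)ω = (ω·∇)u + νΔω`, Majda–Bertozzi Prop. 1.12, and the second-order condition
`⟪ω, Δω⟫(x₀) ≤ 0`). [cite: Rhodes2026, Step 2 (a)(b) p.6 l.63–90] [cite: MajdaBertozzi2002, §1.6 Prop. 1.12] [cite: Lieberman1996, Ch. II Lemma 2.1 (proof)] -/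
theorem step2_MaxIdentities_holds : Step2_MaxIdentities := by
  intro ν u₀ T u p hν h t₀ ht₀ x₀ hmax
  have hT : 0 < T := ht₀.1.trans_lt ht₀.2
  have hV : ContDiff ℝ ∞ (curl (u t₀)) := contDiff_infty_curl_slice (h.classical.contDiff_velocity ht₀)
  have hmax' : ∀ x, ‖curl (u t₀) x‖ ^ 2 ≤ ‖curl (u t₀) x₀‖ ^ 2 := fun x =>
    pow_le_pow_left₀ (norm_nonneg _) (hmax x) 2
  have ha : ⟪curl (u t₀) x₀, fderiv ℝ (curl (u t₀)) x₀ (u t₀ x₀)⟫ = 0 :=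
    inner_fderiv_eq_zero_of_forall_norm_sq_le hV hmax' _
  refine ⟨ha, ?_⟩
  have hΔ : ⟪curl (u t₀) x₀, Δ (curl (u t₀)) x₀⟫ ≤ 0 :=
    inner_laplacian_nonpos_of_forall_norm_sq_le hV hmax'
  have hvort := h.classical.vorticity_eq (uniqueDiffOn_Ico 0 T) (Ico_zero_subset_closure_interior hT)
    (fun s _ y => curl_zero y) ht₀ x₀
  -- `vorticity u t = curl (u t)` and `fun t x => curl (u t) x` is `vorticity u`
  have hW : timeDerivWithin (Ico 0 T) (fun t x => curl (u t) x) t₀ x₀ =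
      convect (curl (u t₀)) (u t₀) x₀ + ν • Δ (curl (u t₀)) x₀ - convect (u t₀) (curl (u t₀)) x₀ :=
    eq_sub_of_add_eq hvort
  rw [hW, inner_sub_right, inner_add_right, inner_smul_right]
  simp only [convect, production]
  nlinarith [hΔ, hν, ha]

/-- `Step2_MaxIdentities` — `_holds` alias of `step2_MaxIdentities_holds` above under the fact's exact name (appended
2026-08-28, D-0026 bookkeeping: the proof term is the existing theorem of this file; no statement,
definition or attribute is edited; no new named fact; the ledger's debt table listed the fact
unproved). [cite: Lieberman1996, Ch. II Lemma 2.1 (proof)] -/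
theorem _root_.Literature.Claims.NS.Rhodes2026.Step2_MaxIdentities_holds : Step2_MaxIdentities :=
  _root_.Literature.Claims.NS.Rhodes2026.step2_MaxIdentities_holds

/-- **(40)–(41) p.13 HOLD** in the integrated form typed (`C_CZ = 1`): if `|ω| ≤ M` on
`[0, t] × ℝ³` then `E(t) ≤ E(0) e^{2Mt}` — the tree's Grönwall step on the closed slab `[0, t]`
(`integral_sq_norm_curl_le_mul_exp_of_weight_slab`, Chae–Choe 1999) with the constant weight
`a = 2M`, fed the stretching estimate `2∫⟪ω,(∇u)ω⟫ ≤ M(∫‖∇u‖² + ∫|ω|²) ≤ 2M∫|ω|²` (pointwise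
Cauchy–Schwarz and the `div`–`curl` bound `∫|∇u|²_F ≤ ∫|ω|²`), exactly as in the tree's
Beale–Kato–Majda enstrophy bound. [cite: Rhodes2026, (40)–(41) p.13 l.11–28; Remark 4.3 (D) p.15] [cite: ChaeChoe1999, proof of Thm. 1 (the Grönwall step, p. 4)] [cite: MajdaBertozzi2002, Thm. 3.6 proof, (3.80)-(3.82)] -/
theorem step_Gronwall41_holds : Step_Gronwall41 := by
  refine ⟨1, one_pos, ?_⟩
  intro ν u₀ T u p hν h t ht M hM
  rcases ht.1.eq_or_lt with h0 | ht0
  · rw [← h0]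
    simp
  have hM0 : 0 ≤ M := (norm_nonneg _).trans (hM 0 ⟨le_rfl, ht0.le⟩ 0)
  -- the closed slab `[0, t]`
  have hS : IsClassicalNSSolutionOn (Icc 0 t) ν 0 u p :=
    h.classical.mono (Icc_subset_Ico_right ht.2) (uniqueDiffOn_Icc ht0)
  have hB : HasBoundedSobolevNormsOn (Icc 0 t) u :=
    hasBoundedSobolevNormsOn_Icc_of_finiteEnergy_Ico hν h.datum.2.2 h.classical h.initial h.energy
      t ht.2
  have hfin : ∀ n, ∀ s ∈ Icc 0 t, ∫⁻ x, ‖iteratedFDeriv ℝ n (u s) x‖ₑ ^ 2 < ⊤ := fun n s hs => by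
    obtain ⟨C, hC⟩ := hB n
    exact (hC s hs).trans_lt ENNReal.coe_lt_top
  obtain ⟨C₁', hC₁'⟩ := hB 1
  have hsm : ∀ s ∈ Icc 0 t, ContDiff ℝ ∞ (u s) := fun s hs => hS.contDiff_velocity hs
  have hsm3 : ∀ s ∈ Icc 0 t, ContDiff ℝ 3 (u s) := fun s hs => (hsm s hs).of_le (by norm_cast)
  have hsm2 : ∀ s ∈ Icc 0 t, ContDiff ℝ 2 (u s) := fun s hs => (hsm s hs).of_le (by norm_cast)
  obtain ⟨B₁, hB₁0, hB₁⟩ := exists_forall_norm_fderiv_le_of_hasBoundedSobolevNormsOn hsm3 hB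
  set κ : ℝ := ‖curlCLM‖ with hκ
  have hκ0 : 0 ≤ κ := by rw [hκ]; exact norm_nonneg curlCLM
  -- the weight `a = 2M`, `∫₀ᵗ a = 2Mt`
  have hA : ∫⁻ _ in Ioo 0 t, ENNReal.ofReal (2 * M) ≤ ENNReal.ofReal (2 * M * t) := by
    rw [setLIntegral_const, Real.volume_Ioo, sub_zero, ← ENNReal.ofReal_mul (by positivity)]
  -- the stretching estimate with the constant weight
  have hstr : ∀ s ∈ Icc 0 t,
      2 * ∫ x, ⟪curl (u s) x, fderiv ℝ (u s) x (curl (u s) x)⟫ ≤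
        ν * (∫ x, frobeniusNormSq (fderiv ℝ (curl (u s)) x)) +
          2 * M * (∫ x, ‖curl (u s) x‖ ^ 2) := by
    intro s hs
    have hv := hsm3 s hs
    have hv2 := hsm2 s hs
    have hw1 : ContDiff ℝ 1 (curl (u s)) := contDiff_curl (n := 1) (by exact hv2)
    have cw : Continuous (curl (u s)) := hw1.continuous
    have cDv : Continuous (fderiv ℝ (u s)) := hv.continuous_fderiv (by norm_num)
    -- `L²` facts
    have l2w : ∫⁻ x, ‖curl (u s) x‖ₑ ^ 2 < ⊤ := by
      refine lintegral_enorm_sq_lt_top_of_norm_le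
        (b := fun x => (κ : ℝ) • iteratedFDeriv ℝ 1 (u s) x)
        (fun x => ?_) (lintegral_enorm_sq_const_smul_lt_top _ (hfin 1 s hs))
      rw [norm_smul, Real.norm_of_nonneg hκ0, norm_iteratedFDeriv_one]
      exact norm_curl_le (u s) x
    have l2Dv : ∫⁻ x, ‖fderiv ℝ (u s) x‖ₑ ^ 2 < ⊤ := by
      refine lt_of_le_of_lt (le_of_eq (lintegral_congr fun x => ?_)) (hfin 1 s hs)
      rw [← ofReal_norm, ← ofReal_norm, norm_iteratedFDeriv_one]
    have l2u : ∫⁻ x, ‖u s x‖ₑ ^ 2 < ⊤ := by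
      refine lt_of_le_of_lt (le_of_eq (lintegral_congr fun x => ?_)) (hfin 0 s hs)
      rw [← ofReal_norm, ← ofReal_norm, norm_iteratedFDeriv_zero]
    have iY : Integrable fun x => ‖curl (u s) x‖ ^ 2 := integrable_sq_norm_of_lintegral_lt_top cw l2w
    have iD : Integrable fun x => ‖fderiv ℝ (u s) x‖ ^ 2 :=
      integrable_sq_norm_of_lintegral_lt_top cDv l2Dv
    have hFEle : ∫⁻ x, ENNReal.ofReal (frobeniusNormSq (fderiv ℝ (u s) x)) ≤ 3 * (C₁' : ℝ≥0∞) := by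
      calc ∫⁻ x, ENNReal.ofReal (frobeniusNormSq (fderiv ℝ (u s) x))
          ≤ ∫⁻ x, 3 * ‖fderiv ℝ (u s) x‖ₑ ^ 2 :=
            lintegral_mono fun x => ofReal_frobeniusNormSq_le_three_mul_enorm_sq _
        _ = 3 * ∫⁻ x, ‖iteratedFDeriv ℝ 1 (u s) x‖ₑ ^ 2 := by
            rw [lintegral_const_mul' _ _ (by norm_num)]
            congr 1
            exact lintegral_congr fun x => by
              rw [← ofReal_norm, ← norm_iteratedFDeriv_one, ofReal_norm]
        _ ≤ 3 * (C₁' : ℝ≥0∞) := mul_le_mul' le_rfl (hC₁' s hs)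
    have iF : Integrable fun x => frobeniusNormSq (fderiv ℝ (u s) x) := by
      have hlt : ∫⁻ x, ENNReal.ofReal (frobeniusNormSq (fderiv ℝ (u s) x)) < ⊤ :=
        hFEle.trans_lt (ENNReal.mul_lt_top (by norm_num) ENNReal.coe_lt_top)
      exact integrable_of_continuous_of_nonneg (continuous_frobeniusNormSq_fderiv hv2 (by simp))
        (fun x => frobeniusNormSq_nonneg _) hlt
    have iS : Integrable (fun x => ⟪curl (u s) x, fderiv ℝ (u s) x (curl (u s) x)⟫) volume := by
      refine (iY.const_mul B₁).mono' (cw.inner (cDv.clm_apply cw)).aestronglyMeasurable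
        (Eventually.of_forall fun x => ?_)
      rw [Real.norm_eq_abs]
      calc |⟪curl (u s) x, fderiv ℝ (u s) x (curl (u s) x)⟫|
          ≤ ‖curl (u s) x‖ * ‖fderiv ℝ (u s) x (curl (u s) x)‖ := abs_real_inner_le_norm _ _
        _ ≤ ‖curl (u s) x‖ * (‖fderiv ℝ (u s) x‖ * ‖curl (u s) x‖) :=
            mul_le_mul_of_nonneg_left (ContinuousLinearMap.le_opNorm _ _) (norm_nonneg _)
        _ ≤ ‖curl (u s) x‖ * (B₁ * ‖curl (u s) x‖) := by
            gcongr
            exact hB₁ s hs x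
        _ = B₁ * ‖curl (u s) x‖ ^ 2 := by ring
    -- pointwise: `⟪ω, (∇u)ω⟫ ≤ M (‖∇u‖² + |ω|²)/2`
    have hpt : ∀ x, ⟪curl (u s) x, fderiv ℝ (u s) x (curl (u s) x)⟫ ≤
        M / 2 * ‖fderiv ℝ (u s) x‖ ^ 2 + M / 2 * ‖curl (u s) x‖ ^ 2 := by
      intro x
      have h1 : ⟪curl (u s) x, fderiv ℝ (u s) x (curl (u s) x)⟫ ≤
          ‖curl (u s) x‖ * (‖fderiv ℝ (u s) x‖ * ‖curl (u s) x‖) :=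
        (le_abs_self _).trans ((abs_real_inner_le_norm _ _).trans
          (mul_le_mul_of_nonneg_left (ContinuousLinearMap.le_opNorm _ _) (norm_nonneg _)))
      have h2 : ‖curl (u s) x‖ * (‖fderiv ℝ (u s) x‖ * ‖curl (u s) x‖) ≤
          M * (‖fderiv ℝ (u s) x‖ * ‖curl (u s) x‖) :=
        mul_le_mul_of_nonneg_right (hM s hs x) (by positivity)
      nlinarith [h1, h2, sq_nonneg (‖fderiv ℝ (u s) x‖ - ‖curl (u s) x‖), hM0]
    have hS1 : ∫ x, ⟪curl (u s) x, fderiv ℝ (u s) x (curl (u s) x)⟫ ≤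
        M / 2 * (∫ x, ‖fderiv ℝ (u s) x‖ ^ 2) + M / 2 * (∫ x, ‖curl (u s) x‖ ^ 2) := by
      rw [← integral_const_mul, ← integral_const_mul,
        ← integral_add (iD.const_mul _) (iY.const_mul _)]
      exact integral_mono iS ((iD.const_mul _).add (iY.const_mul _)) hpt
    -- `∫‖∇u‖² ≤ ∫|∇u|²_F ≤ ∫|ω|²`
    have hDF : ∫ x, ‖fderiv ℝ (u s) x‖ ^ 2 ≤ ∫ x, frobeniusNormSq (fderiv ℝ (u s) x) :=
      integral_mono iD iF fun x => sq_opNorm_le_frobeniusNormSq _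
    have hFY : ∫ x, frobeniusNormSq (fderiv ℝ (u s) x) ≤ ∫ x, ‖curl (u s) x‖ ^ 2 := by
      have h := lintegral_frobeniusNormSq_fderiv_le_lintegral_sq_norm_curl hv2 (hS.divFree s hs) l2u
      rw [← ofReal_integral_eq_lintegral_ofReal iF
        (Eventually.of_forall fun x => frobeniusNormSq_nonneg _)] at h
      have h' : ENNReal.ofReal (∫ x, frobeniusNormSq (fderiv ℝ (u s) x)) ≤
          ENNReal.ofReal (∫ x, ‖curl (u s) x‖ ^ 2) := by
        refine h.trans (le_of_eq ?_)
        rw [ofReal_integral_eq_lintegral_ofReal iY (Eventually.of_forall fun x => sq_nonneg _)]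
        exact lintegral_congr fun x => by rw [← ofReal_norm, ENNReal.ofReal_pow (norm_nonneg _)]
      exact (ENNReal.ofReal_le_ofReal_iff (integral_nonneg fun x => sq_nonneg _)).1 h'
    have hDnn : 0 ≤ ∫ x, frobeniusNormSq (fderiv ℝ (curl (u s)) x) :=
      integral_nonneg fun x => frobeniusNormSq_nonneg _
    have hY0' : 0 ≤ ∫ x, ‖curl (u s) x‖ ^ 2 := integral_nonneg fun x => sq_nonneg _
    nlinarith [hS1, hDF, hFY, hν, hDnn, hM0, hY0']
  -- Grönwall on `[0, t]`
  have hmain := integral_sq_norm_curl_le_mul_exp_of_weight_slab hν ht0 hS hB (a := fun _ => 2 * M)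
    (fun _ => by positivity) (A := 2 * M * t) (by positivity) hA hstr t ⟨ht0.le, le_rfl⟩
  unfold enstrophy
  rw [show 2 * 1 * M * t = 2 * M * t by ring]
  calc 1 / 2 * ∫ x, ‖curl (u t) x‖ ^ 2
      ≤ 1 / 2 * ((∫ x, ‖curl (u 0) x‖ ^ 2) * Real.exp (2 * M * t)) := by gcongr
    _ = 1 / 2 * (∫ x, ‖curl (u 0) x‖ ^ 2) * Real.exp (2 * M * t) := by ring

/-- `Step_Gronwall41` — `_holds` alias of `step_Gronwall41_holds` above under the fact's exact name (appended
2026-08-28, D-0026 bookkeeping: the proof term is the existing theorem of this file; no statement,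
definition or attribute is edited; no new named fact; the ledger's debt table listed the fact
unproved). [cite: MajdaBertozzi2002, Thm. 3.6 proof, (3.80)-(3.82)] -/
theorem _root_.Literature.Claims.NS.Rhodes2026.Step_Gronwall41_holds : Step_Gronwall41 :=
  _root_.Literature.Claims.NS.Rhodes2026.step_Gronwall41_holds

/-! ## D-0026 debt pass (ns-claims-lit-4 g7, 2026-08-27): Lemma 3.4 (8) certified in the kernel

`lemma34_holds : Lemma34`, with the PRINTED constant `C₁ = 2 (2/(4π))^{1/3}` (p.6 l.23). Along a solution
of the class every slice is the Biot–Savart velocity of its vorticity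
(`biotSavart_curl_eq_self_of_lintegral_sq_lt_top`, `BiotSavartRepresentationSqIntegrable.lean`: the slice
is `C^∞` and divergence free, lies in `L²` by `IsSol.energy`, and `curl u(t) ∈ L²` by the Sobolev bounds
`hasBoundedSobolevNormsOn_Icc_of_finiteEnergy_Ico` on the closed sub-slab `[0, t]`), and the near/far
splitting bound of the print — `‖K₃ ∗ ω‖_∞ ≤ 2 (4π)^{-1/3} ‖ω‖_∞^{1/3} (∫|ω|²)^{1/3}`, tree
`norm_biotSavart_le_rpow_third` (`BiotSavartSupInterpolation.lean`, landed for this pass with the printed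
proof: near field `MR`, far field `√(2ℰ)/√(4πR)`, optimal `R`) — gives (8) since `∫|ω(t)|² = 2ℰ(t)`.
Nothing above is touched. -/

section Lemma34Proof

/-- **Lemma 3.4 (8) p.5 HOLDS**: there is an absolute `C₁ > 0` (the printed `2 (2/(4Real.pi))^{1/3} ≈ 1.08`)
with `|u(x, t)| ≤ C₁ M^{1/3} ℰ(t)^{1/3}` for every solution of the class, every `t ∈ [0, T)`, every
bound `M` of `|ω(·, t)|` and every `x` — Biot–Savart representation of the slice plus the tree's
splitting estimate. [cite: Rhodes2026, Lemma 3.4 (8) p.5 l.44–58, proof p.5 l.59 – p.6 l.23] -/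
theorem lemma34_holds : Lemma34 := by
  refine ⟨2 * (2 / (4 * Real.pi)) ^ (1 / 3 : ℝ), by positivity, ?_⟩
  intro ν u₀ T u p hν hs t ht M hM x
  -- regularity of the slice
  have hsm : ContDiff ℝ ∞ (u t) := hs.classical.smooth_velocity.contDiff_slice ht
  have hs2 : ContDiff ℝ 2 (u t) := hsm.of_le (by norm_cast)
  have hs1 : ContDiff ℝ 1 (u t) := hsm.of_le (by norm_cast)
  have hωc : Continuous (curl (u t)) := continuous_curl hs1
  -- the slice and its curl are square integrable
  have hu2 : ∫⁻ y, ‖u t y‖ₑ ^ 2 < ⊤ := by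
    obtain ⟨A, hA, hAE⟩ := hs.energy
    exact (hAE t ht).trans_lt hA
  have htI : t ∈ Icc 0 t := ⟨ht.1, le_rfl⟩
  have hB := hasBoundedSobolevNormsOn_Icc_of_finiteEnergy_Ico hν hs.datum.2.2 hs.classical
    hs.initial hs.energy t ht.2
  obtain ⟨C, hC⟩ := hB 1
  have hω2 : ∫⁻ y, ‖curl (u t) y‖ₑ ^ 2 < ⊤ := by
    have hle : ∀ y, ‖curl (u t) y‖ₑ ^ 2 ≤
        ENNReal.ofReal (‖curlCLM‖ ^ 2) * ‖iteratedFDeriv ℝ 1 (u t) y‖ₑ ^ 2 := by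
      intro y
      have h := norm_curl_le (u t) y
      rw [← norm_iteratedFDeriv_one] at h
      calc ‖curl (u t) y‖ₑ ^ 2 = ENNReal.ofReal (‖curl (u t) y‖ ^ 2) := by
            rw [← ofReal_norm, ENNReal.ofReal_pow (norm_nonneg _)]
        _ ≤ ENNReal.ofReal ((‖curlCLM‖ * ‖iteratedFDeriv ℝ 1 (u t) y‖) ^ 2) :=
            ENNReal.ofReal_le_ofReal (pow_le_pow_left₀ (norm_nonneg _) h 2)
        _ = ENNReal.ofReal (‖curlCLM‖ ^ 2) * ‖iteratedFDeriv ℝ 1 (u t) y‖ₑ ^ 2 := by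
            rw [mul_pow, ENNReal.ofReal_mul (sq_nonneg _), ← ofReal_norm (iteratedFDeriv ℝ 1 (u t) y),
              ENNReal.ofReal_pow (norm_nonneg _)]
    calc ∫⁻ y, ‖curl (u t) y‖ₑ ^ 2
        ≤ ∫⁻ y, ENNReal.ofReal (‖curlCLM‖ ^ 2) * ‖iteratedFDeriv ℝ 1 (u t) y‖ₑ ^ 2 := lintegral_mono hle
      _ = ENNReal.ofReal (‖curlCLM‖ ^ 2) * ∫⁻ y, ‖iteratedFDeriv ℝ 1 (u t) y‖ₑ ^ 2 :=
          lintegral_const_mul' _ _ ENNReal.ofReal_ne_top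
      _ < ⊤ := ENNReal.mul_lt_top ENNReal.ofReal_lt_top ((hC t htI).trans_lt ENNReal.coe_lt_top)
  -- the slice is the Biot–Savart velocity of its vorticity
  have hrep : biotSavart (curl (u t)) = u t :=
    biotSavart_curl_eq_self_of_lintegral_sq_lt_top hs2 (hs.classical.divFree t ht) hu2 hω2
  -- the splitting estimate
  have hI : Integrable (fun y => ‖curl (u t) y‖ ^ 2) := integrable_sq_norm_of_lintegral_lt_top hωc hω2
  have h := norm_biotSavart_le_rpow_third hωc.aestronglyMeasurable hM hI x
  rw [hrep] at h
  have hE0 : 0 ≤ enstrophy u t := by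
    unfold enstrophy
    exact mul_nonneg (by norm_num) (integral_nonneg fun _ => sq_nonneg _)
  have hE : (∫ y, ‖curl (u t) y‖ ^ 2) = 2 * enstrophy u t := by
    unfold enstrophy
    ring
  rw [hE, Real.mul_rpow (by norm_num) hE0] at h
  have e1 : (2 / (4 * Real.pi)) ^ (1 / 3 : ℝ) = (2 : ℝ) ^ (1 / 3 : ℝ) * ((4 * Real.pi)⁻¹) ^ (1 / 3 : ℝ) := by
    rw [div_eq_mul_inv, Real.mul_rpow (by norm_num) (by positivity)]
  calc ‖u t x‖ ≤ 2 * ((4 * Real.pi)⁻¹) ^ (1 / 3 : ℝ) * M ^ (1 / 3 : ℝ) *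
        ((2 : ℝ) ^ (1 / 3 : ℝ) * (enstrophy u t) ^ (1 / 3 : ℝ)) := h
    _ = 2 * (2 / (4 * Real.pi)) ^ (1 / 3 : ℝ) * M ^ (1 / 3 : ℝ) * (enstrophy u t) ^ (1 / 3 : ℝ) := by
        rw [e1]
        ring

end Lemma34Proof

end Literature.Claims.NS.Rhodes2026

end

-- WHAT THIS IS NOT: not a claim about NS regularity or blow-up; not a claim about any author beyond the
-- typed locator.
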